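import Literature.MathematicalPhysics.QuantumFieldTheory.Balaban1983to89.B9Eq3105FamThreeTAtLocCfgOfTails
import Literature.MathematicalPhysics.QuantumFieldTheory.Balaban1983to89.B9Eq3105FamThreeAtMember
import Literature.MathematicalPhysics.QuantumFieldTheory.Balaban1983to89.B9Eq3105FamTwoAtMember

/-!
# `Balaban1983to89.B9Eq3105FamThreeTAtMember` — THE TRANSPOSED (`hV′`) FAMILY 3 OF [B9] (3.105) AS AN ∃-THRESHOLD PACKAGE AT THE MEMBER: the `hV′` record
# `B9Eq3105FamThreeTAtLocCfgOfTails.hasMajorant_sum_famThreeT_at_locCfg_of_tails` (p38 g48: hDL ← p33 E2d, hDR ← p38 E3c, hP3 ← p33 FILE 6) with ALL its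
# displayed cube-side letters, located tails, [4] (2.61) inequalities, scale transfers and ≈65 rate ∕ budget letters DISCHARGED above one threshold on
# `M = L·M_h` — kernel `Θ₃ᵀ·e^{−κ₃ᵀM_h}·e^{−ρ₃ᵀd}` with `ρ₃ᵀ, κ₃ᵀ, Θ₃ᵀ` MEMBER-INDEPENDENT — the TWIN of p33 g105's P3 `B9Eq3105FamThreeAtMember.famThree_at_member`
# (sub-row G-B8-T2S ∕ G-B9-LETTERS, the bond-sector member ASSEMBLER, file P3T; lead g35 GO ASSEMBLER ROAD 06:45Z 2026-08-29 «P3T = p38 lineage», RULING FAMTHREE-6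
# «each lineage plugs its own record»; seat p38 gen 48)

T. Bałaban, *Propagators for lattice gauge theories in a background field*, Commun. Math. Phys. **99** (1985) 389–434 [`Balaban1985BackgroundPropagators`, "B9"];
[4] = T. Bałaban, *Propagators and renormalization transformations for lattice gauge theories. II*, Commun. Math. Phys. **96** (1984) 223–250
[`Balaban1984PropagatorsII`].

statement-level skeleton of published theorems with citation tags; proofs where landed; nothing here is a claim about the Yang–Mills mass gap

THE PRINTED LOCUS (held `paper:balaban1985-cmp99-background-propagators`, journal page = PDF page + 388).  p. 414 (3.105), third sum «− Σ_□ ζ_□̃(DPD* −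
DP_□D*)h_□G_□h_□» and (3.106) «G = G₀(I − R)⁻¹» (the tree's `hV′` is M5.7's device: the expansion multiplied from the right, so the family is read with the `h_□O_□h_□`
factor in front); p. 415 l. 26–37; p. 411 l. 36–41 «The characteristic function 1 − □̃ at the beginning of the term, and the function h_□ at the end, restrict a kernel
of the term to points separated at least by a distance MLʲη (if □ ∈ 𝒟_j). Hence the part of the exponential factor can be estimated by e^{−(1∕4)δ₀M}»; Cor. 3.6 p. 408; (3.104)
p. 414; Thm 3.10 p. 416; [4] Lemma 2.1 (2.60)–(2.61) p. 234.

WHY THIS FILE (cell `lit-balaban`; the bond-sector MEMBER ASSEMBLER of the torus [B8] Thm 2 cover form; p33 g105's scope memo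
`run/shared/lean/pub/lit-balaban/lit-balaban-p33/g105/ASSEMBLER-SCOPE.md`, p38's `lit-balaban-p38/P3T-SCOPE.md`).  The `hrest` and the `hV′` majorants of
M5.7's endpoint each carry a family-3 summand; p33's P3 packages the `hrest` one.  THIS FILE is its transposed twin: the SAME rate unit `m` (now
`m = min(δ_G, δ_X, δ_O, δ_S, δ_C, δ_B, δ_Q)`, `δ_Q` the rate of the (3.104) cube letter), the SAME six member (2.61) pairs but the last group at `(δ_O, r′∕8)`, the SAME
cube (2.61)s plus one for the cube datum, the SAME transfers plus the `ℓ²` transfer of the transposed record (`hT2`) and the `ℓ⁻²` transfer of its last group, the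
SAME per-cube packages (E3f `commSteps_at_datum`, p21 `cinv_cube_at_locCfg`, p33 `gp_cube_entries_at_locCfg`) plus the hV′-only cube datum `hPlC □` ∕ `h261C □`
(§0 `plC_at_datum` = `B9Cor36DPDsCubeAtLocCfg.hasMajorant_conj_DPDsCubeY_at_locCfg` ∧ `exists_h261_geoCK`, one ∃-package), the SAME located tails (p33 FILES 8a∕8b∕8c
BY NAME) and the SAME three budgets `ε_T`, `ε_R`, `ε₃` with the collar factors bounded by `E = e^{−(3m∕128)(3M_h∕8 − 3)}`; the transposed record's extra (3.49)
collar `e^{−a_sep·δ_O·D_sep}` (`a_sep = r′∕4`, `D_sep = M_h∕(2L)`, p33 P2 `exp_DsepT_eq`) sets the member-independent rate `κ₃ᵀ = (m∕64)∕(2L) ≤ 9m∕1024`.  p33's P3 text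
(`famThree_at_member`, 720 l.) is followed line by line; its §0 helpers `scaleTransfer_len_inv_pow_geo9K`, `exp_collar_le` are used BY NAME.

WHAT THIS FILE PROVES (theorems only; 0 `def`, 0 `def … : Prop`, 0 sorry; standard axioms).
* §0 ★ `plC_at_datum` — the (3.104) cube letter's majorant `hPlC □` (`conj b((D_ṼP_□(Ṽ_□)D_Ṽ*)^ℝ) ≺ K_Q·ℓ_□⁻²·e^{−δ_Qd_□}` on `(toB6 (geoCK i □) Rr H, blkBK)`) AND its cube
  (2.61) at `α = ½` in ONE ∃-package over all members above one threshold (max ∕ min bookkeeping over two landed packages); `kernel_collect` (real bookkeeping of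
  the final kernel: `x + e₃ ≤ (X₁+ε₃₁)E`, `E ≤ e₉F` ⟹ the record's constant `≤ Θ·F`).
* §1 ★★★ `famThreeT_at_member` — the ∃-threshold package described above (rates: `ρ₃ᵀ = (r′∕8)·δ_O`, `r′ = m∕(16δ_O)`; `κ₃ᵀ = (m∕64)∕(2L)`); displayed exactly what P3
  displays (`hE`, `Oc`∕`hEO`, `ιB`∕`hι`, `hpar`, `hCinv`, `hU`, `hX`, `hparV`, `η` via `c_f = L^k`, the twelve (3.35) clauses per cube, bi-contractive `u_□`).

HONEST SCOPE.  Pure ∃-bookkeeping over landed theorems; no estimate of [B9] is added.  NOT here: the knit into `hV′` (p33's ASM1), the smallness threshold (ASM2),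
families 2T ∕ 4T, the defect family.  Count-neutral; NOT a node discharge; no summit ∕ node statement proved; nothing continuum ∕ OS ∕ mass gap ∕ Clay; YM mass gap
NOT proved (Track A conditional rung).  No `sorry`, no `axiom`, no `… : Prop` fact, no `instance`, no `notation`, no `def`.  NEW file; nothing landed is modified.
`𝔸` with `‖1‖ = 1` (as E3f ∕ the cube packages).  Cell `lit-balaban`, seat `lit-balaban-p38` gen 48, 2026-08-29; `--supports stmt-QuantumFields-19200`.  Net new unproved
facts: 0.

RELATED IN THE TREE, NOT DUPLICATED (searched 2026-08-29: `rg 'famThreeT_at_member|FamThreeTAtMember|plC_at_datum' Literature/` = ∅): p33 P3 `B9Eq3105FamThreeAtMember`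
(the `hrest` twin — followed line by line; its §0 used BY NAME), the record `B9Eq3105FamThreeTAtLocCfgOfTails`, p33 P2 `B9Eq3105FamTwoAtMember.exp_DsepT_eq`,
`B9Cor36DPDsCubeAtLocCfg`, `B9GeoInputsMultiRateKLevelV1`, `B9CubeGeometryInputs`, FILES 8a∕8b∕8c, E3f — USED BY NAME.
-/


noncomputable section

open scoped BigOperators

namespace Literature.MathematicalPhysics.QuantumFieldTheory.Balaban1983to89.B9Eq3105FamThreeTAtMember

open NormedSpace Complex
open B6RandomWalk (HasMajorant hasMajorant_mono Ineq261 c1_nonneg)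
open B6RandomWalkHom (HasMajorantHom)
open B9Thm34Ext (toB6)
open B9FromB6 (EBlock)
open B9Ineq347 (ScaleTransfer)
open B9Eq352DivFormLetters (conj)
open B9Eq352GradLetters (diffLetter)
open B9Eq376POneLetters (conjHom)
open B9Eq39Adjoint (fluct covD)
open B9Eq360DeltaPrimeAY (AfldY)
open B9Eq360DeltaPrimeACubeY (blkCubeY)
open B6KLevelCensusIndexV1 (KIdx kGeo)
open B6Cover236MultiLevelBlocks (cubes)
open B6GlobalChartV1 (PV boxEquiv blkV1)
open B6Geom246MultiLevelBox (blkOf)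
open B6Ineq2142KLevelV1 (β)
open B9GeoNormsKLevelV1 (geo9K)
open B9GeoLemma21KLevelV1 (transferL_geo9K geo9K_len_pos one_le_Mh)
open B9GeoInputsMultiRateKLevelV1 (ineq261_three_geo9K scaleTransfer_len_sq_geo9K scaleTransfer_len_inv4_geo9K)
open B9Cor36GCubeLocDefectAtLocCfg (scaleTransfer_len_geo9K)
open B9RWSums347DefiniteFaces (exp261)
open B9RWSums347DefiniteFacesWindow (scaleTransfer_mono_const)
open B9BackgroundsKLevelV1 (shiftsV1)
open B9CubeGeometryInputs (geoCK geoCK_dist_axioms RM1 N1 exists_h261_geoCK hST_geoCK)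
open B9CubeLettersOpsL0 (deltaPrimeACubeY GpCubeY)
open B9CubeLettersBondOpsL0 (QpCubeY QpsCubeY XCubeY XinvCubeY BlkCubeY)
open B9CubeLettersInvReadings (kernelFamilySInv kernelFamilyBInv)
open B9Thm37CubeCoverCommutators (cutMulY hTY)
open B4PartitionUnity22 (thetaProf D1 D1_nonneg contDiff_thetaProf hasCompactSupport_thetaProf)
open B9Cor36CutoffField337 (bumpY)
open B9Cor36CubeCutoffs (SC NearC chiY ctrR locCfgY one_le_SC)
open B9Eq359CubeKernelsAtOne (Cq Cq_nonneg)
open B9Cor35CinvAtCubeLetters (kernel_rate_mono)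
open B9Eq3104CutoffCommutators (hBdY DPDsY)
open B9Eq3105ZetaY (zetaY)
open B9Cor36GCubeLocLetter (locProjBY)
open B9Cor36GpCubeExtAtV (GpVK)
open B9Cor36GpCubeEntriesAtV (gp_cube_entries_at_locCfg)
open B9Cor36CinvCubeAtLocCfg (cinv_cube_at_locCfg)
open B9Thm37Sum (mulOp mulOp_apply)
open B9Eq3105FamThreeTAtLocCfgOfTails (hasMajorant_sum_famThreeT_at_locCfg_of_tails)
open B9Eq3105FamThreeAtMember (scaleTransfer_len_inv_pow_geo9K exp_collar_le)
open B9Eq3105FamTwoAtMember (exp_DsepT_eq)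
open B9Cor36DPDsCubeAtLocCfg (hasMajorant_conj_DPDsCubeY_at_locCfg)
open B9Cor35GCubeInputsAtOne (blkBK)
open B9Eq3105AtLetters (DPDsCubeY)
open B9Thm39CinvAtCover (DsepT)
open B9Ineq368PPrime (kappa349)
open B9Eq3105FamThreeCommStepAtDatum (isUnit_deltaPrimeACubeY_gauge_inv)
open B9Eq3105FamThreeCommStepAdjAtDatum (hasMajorant_conj_commStepAdj_member_rate)
open B9Eq3105FamThreeCommStepsAtDatum (commSteps_at_datum kernel_weaken)
open B9Eq3105FamThreeLocCDiffOuterEntries (hasMajorant_rightEntry_at hasMajorant_leftEntry_at)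
open B9Eq3105FamThreeLocCDiffCubeTails (hasMajorant_tail0_at hasMajorant_tail1_at hasMajorant_tail2_at hasMajorant_sbL_at hasMajorant_gw_at
  hasMajorant_projCube_member)
open B9Eq3105FamThreeLocCDiffCubeTailsGK (hasMajorant_tk_at)
open B9Eq3105FamThreeLocCDiffCubeTailsGK.CubeData (GpVK_eq_conj_smul hasMajorant_resolventCube_of_cinv isUnit_XCubeY_gauge)
open Node00 (SiteY BlkY IBondY FBondY CfgY GaugeY SiteOpY BondOpY SiteParY BondParY toKT shiftY UboxY GpY deltaPrimeAY gaugeY parSymY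
  parSymY_isGaugeLawS etaS QpY QpsY XY XinvY)

variable {d ℓ : ℕ} {hd : 1 ≤ d + 1} {hL : Odd (ℓ + 1) ∧ 1 < ℓ + 1} {b₀ b₁ : ℝ}
variable {𝔸 : Type} [NormedRing 𝔸] [NormedAlgebra ℂ 𝔸] [CompleteSpace 𝔸]
variable {ι : Type} [Fintype ι]

/-! ## §0  The hV′-only cube datum as one ∃-package; the final kernel's bookkeeping -/

section CubeDatum

variable [NormOneClass 𝔸] [DecidableEq ι] (b : Module.Basis ι ℝ 𝔸)

/-- ★ **THE (3.104) CUBE LETTER's MAJORANT `hPlC □` AND ITS CUBE (2.61) (at `α = ½`) IN ONE ∃-PACKAGE** over all members above one threshold: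
`B9Cor36DPDsCubeAtLocCfg.hasMajorant_conj_DPDsCubeY_at_locCfg` ∧ `B9CubeGeometryInputs.exists_h261_geoCK` (max ∕ min bookkeeping only).
[cite: Balaban1985BackgroundPropagators, (3.104) p.414, Cor. 3.6 p.408, (3.49) p.399; Balaban1984PropagatorsII, Lemma 2.1 (2.61) p.234] -/
theorem plC_at_datum (hℓ : 1 ≤ ℓ) (M₂ : ℝ) (hM₂ : 0 ≤ M₂) (hrepr : ∀ (v : 𝔸) (j : ι), |b.repr v j| ≤ M₂ * ‖v‖) :
    ∃ δC KC M₀ T₀ : ℝ, ∃ N₀ dC : ℕ, 0 < δC ∧ 0 ≤ KC ∧ ∃ a₁ : ℝ, 0 < a₁ ∧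
    ∀ (i : KIdx d ℓ hd hL b₀ b₁) (c : ↥(cubes (toKT i).D.toDomains)) (Rr : ℝ) (H : Prop),
      M₀ ≤ ((ℓ : ℝ) + 1) * (toKT i).Mh → N₀ + 1 ≤ (toKT i).R * ((ℓ + 1) * (toKT i).Mh) → T₀ ≤ RM1 i →
    ∀ (A : AfldY 𝔸 i) (Q : Set (Site (PV d ℓ i.m i.K hd hL) 0)) (C ξ Λ : ℝ),
      0 ≤ C → 0 < ξ → 1 ≤ Λ → ξ ≤ 5 * (SC i c : ℝ) * (kGeo i).eta → LatticeNorms.scaleLen ((ℓ : ℝ) + 1) (kGeo i).eta (c.1.1 + 1) ≤ Λ * ξ →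
      (∀ x : Site (PV d ℓ i.m i.K hd hL) 0, NearC i c (35 * SC i c / 8 + 1) (boxEquiv i.hN x).1 → x ∈ Q) →
      (∀ κ, ∀ x ∈ Q, ‖A κ x‖ ≤ C * ξ⁻¹) →
      (∀ μ ν, ∀ x ∈ Q, ‖(((kGeo i).eta : ℂ)⁻¹) • covD (shiftsV1 (PV d ℓ i.m i.K hd hL)) (fun _ _ => (1 : 𝔸ˣ)) μ (A ν) x‖ ≤ C * (ξ ^ 2)⁻¹) →
      max C (C * (1 + D1 thetaProf)) * Λ ^ 2 ≤ a₁ →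
      Ineq261 dC (toB6 (geoCK i c) Rr H) δC (1 / 2) ∧
      HasMajorant (g := toB6 (geoCK i c) Rr H) (blkBK i c)
        (conj b ((DPDsCubeY i c (parSymY i) (locCfgY i c (kGeo i).eta A)).restrictScalars ℝ))
        (fun a y => KC * ((geoCK i c).len a ^ 2)⁻¹ * Real.exp (-(δC * (geoCK i c).dist a y))) := by
  obtain ⟨δP, KP, M₀, T₀, N₀, hδP, hKP, a₁, ha₁, HP⟩ :=
    hasMajorant_conj_DPDsCubeY_at_locCfg (d := d) (hd := hd) (hL := hL) (b₀ := b₀) (b₁ := b₁) b hℓ M₂ hM₂ hrepr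
  obtain ⟨dC, hdC⟩ := exists_h261_geoCK d ℓ hδP
  refine ⟨δP, KP, M₀, T₀, max N₀ (N1 d ℓ (9 / 5000 * δP)), dC, hδP, hKP, a₁, ha₁, ?_⟩
  intro i c Rr H hM hN hT A Q C ξ Λ hC hξ hΛ hξS hΛξ hQ hA hdA hs
  refine ⟨hdC i c Rr H (le_trans (Nat.succ_le_succ (le_max_right _ _)) hN) (1 / 2) (by norm_num) (by norm_num), ?_⟩
  exact HP i c Rr H hM (le_trans (Nat.succ_le_succ (le_max_left _ _)) hN) hT A Q C ξ Λ hC hξ hΛ hξS hΛξ hQ hA hdA hs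

end CubeDatum

/-- Bookkeeping of the final kernel: from `x + e₃ ≤ (X₁ + ε₃₁)·E`, `0 ≤ X₁ + ε₃₁`, `E ≤ e₉·F`, nonnegative outer constants, the transposed record's constant
`c₅·((c_B·((x + e₃) + K·F))·c_L·c_C) ≤ c₅·((c_B·((X₁ + ε₃₁)·e₉ + K))·c_L·c_C)·F`. [cite: Balaban1984PropagatorsII, (2.51)–(2.52) p.232 (kernel shape only)] -/
theorem kernel_collect {c5 cB cL cC X1 x ε31 e3 K E F e9 : ℝ} (h5 : 0 ≤ c5) (hB : 0 ≤ cB) (hL : 0 ≤ cL) (hC : 0 ≤ cC)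
    (hX : x + e3 ≤ (X1 + ε31) * E) (hX1 : 0 ≤ X1 + ε31) (hE : E ≤ e9 * F) :
    c5 * ((cB * ((x + e3) + K * F)) * cL * cC) ≤ c5 * ((cB * ((X1 + ε31) * e9 + K)) * cL * cC) * F := by
  have h1 : x + e3 ≤ (X1 + ε31) * (e9 * F) := hX.trans (mul_le_mul_of_nonneg_left hE hX1)
  have h2 : (x + e3) + K * F ≤ ((X1 + ε31) * e9 + K) * F := by linarith only [h1]
  calc c5 * ((cB * ((x + e3) + K * F)) * cL * cC) ≤ c5 * ((cB * (((X1 + ε31) * e9 + K) * F)) * cL * cC) :=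
        mul_le_mul_of_nonneg_left (mul_le_mul_of_nonneg_right (mul_le_mul_of_nonneg_right (mul_le_mul_of_nonneg_left h2 hB) hL) hC) h5
    _ = c5 * ((cB * ((X1 + ε31) * e9 + K)) * cL * cC) * F := by ring


/-! ## §1 ★★★ The transposed (`hV′`) family 3 of (3.105) as an ∃-threshold package at the member -/

set_option maxHeartbeats 16000000 in
/-- ★★★ **THE TRANSPOSED (`hV′`) FAMILY 3 OF (3.105) AT THE MEMBER, ∃-THRESHOLD PACKAGE** (p. 414 (3.105) third sum `Σ_□ζ_□̃(DPD* − DP_□D*)h_□G_□h_□` read with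
the `h_□O_□h_□` factor in front — (3.106)'s expansion multiplied from the right —, p. 415 l. 26–37, p. 411 «e^{−(1∕4)δ₀M}»).  For block rates ∕ constants `δ_G, δ_X,
δ_O > 0`, `B_G, B₁, B_O ≥ 0` of `G′`, `(Q′G′²Q′*)⁻¹`, `O_□`, a real basis `b` with coordinate bound `M₂` and walk letters `Rr, Hp`, there are MEMBER-INDEPENDENT
`ρ₃, κ₃ > 0`, `Θ₃ ≥ 0`, thresholds `M₀ T₀ N₀` and a (3.37) size `a₁ > 0` such that, at every member above the thresholds with `c_f = L^k`, for every family of per-cube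
(3.35) data exactly as in p33's P3 `famThree_at_member`, every background family through `U`, every bond-sector cube-letter family `O_□` and section `ιB`, GIVEN
`hE`, `hEO`, `hpar`, `hCinv`, `hU`, `hX`, `hparV`:
`Σ_□ conj b(((M_{h_□}O_□M_{h_□})·M_{ζ_□̃}·(DPD*(U₁) − P_{□,loc}(V′_□)))^ℝ) ≺ Θ₃·e^{−κ₃M_h}·e^{−ρ₃d}` on `(f, j) ↦ ιB(Δf₋)` — the record
`hasMajorant_sum_famThreeT_at_locCfg_of_tails` with every cube-side letter, located tail, cube datum, (2.61), scale transfer and rate budget DISCHARGED.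
[cite: Balaban1985BackgroundPropagators, (3.105)–(3.106) p.414, p.415 l.26–37, p.411 l.36–41, (3.104) p.414, Cor. 3.6 p.408, Thm 3.10 p.416; Balaban1984PropagatorsII, Lemma 2.1 (2.60)–(2.61) p.234]-/
theorem famThreeT_at_member [NormOneClass 𝔸] [DecidableEq ι]
    [∀ i' : KIdx d ℓ hd hL b₀ b₁, Fintype (geo9K i').Site] [∀ i' : KIdx d ℓ hd hL b₀ b₁, DecidableEq (geo9K i').Site]
    (Rr : KIdx d ℓ hd hL b₀ b₁ → ℝ) (Hp : KIdx d ℓ hd hL b₀ b₁ → Prop) (b : Module.Basis ι ℝ 𝔸) (hℓ : 1 ≤ ℓ) {M₂ : ℝ} (hM₂ : 0 ≤ M₂)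
    (hrepr : ∀ (v : 𝔸) (j : ι), |b.repr v j| ≤ M₂ * ‖v‖)
    {δG δX δO BG B₁ BO : ℝ} (hδG : 0 < δG) (hδX : 0 < δX) (hδO : 0 < δO) (hBG : 0 ≤ BG) (hB₁ : 0 ≤ B₁) (hBO : 0 ≤ BO) :
    ∃ ρ₃ κ₃ Θ₃ M₀ T₀ : ℝ, ∃ N₀ : ℕ, 0 < ρ₃ ∧ 0 < κ₃ ∧ 0 ≤ Θ₃ ∧ ∃ a₁ : ℝ, 0 < a₁ ∧
    ∀ (i : KIdx d ℓ hd hL b₀ b₁),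
      M₀ ≤ ((ℓ : ℝ) + 1) * (toKT i).Mh → N₀ + 1 ≤ (toKT i).R * ((ℓ + 1) * (toKT i).Mh) → T₀ ≤ RM1 i → i.cf = (((ℓ + 1 : ℕ) : ℝ)) ^ i.k →
    ∀ (U : CfgY 𝔸 i) (u : ↥(cubes (toKT i).D.toDomains) → GaugeY 𝔸 i),
      (∀ c x, ‖((u c x : 𝔸ˣ) : 𝔸)‖ ≤ 1 ∧ ‖(((u c x)⁻¹ : 𝔸ˣ) : 𝔸)‖ ≤ 1) →
    ∀ (A : ↥(cubes (toKT i).D.toDomains) → AfldY 𝔸 i)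
      (Q : ↥(cubes (toKT i).D.toDomains) → Set (Site (PV d ℓ i.m i.K hd hL) 0)) (C ξ Λ : ↥(cubes (toKT i).D.toDomains) → ℝ),
      (∀ c, 0 ≤ C c) → (∀ c, 0 < ξ c) → (∀ c, 1 ≤ Λ c) → (∀ c, ξ c ≤ 5 * (SC i c : ℝ) * (kGeo i).eta) →
      (∀ c, LatticeNorms.scaleLen ((ℓ : ℝ) + 1) (kGeo i).eta (c.1.1 + 1) ≤ Λ c * ξ c) →
      (∀ c, ∀ x : Site (PV d ℓ i.m i.K hd hL) 0, NearC i c (35 * SC i c / 8 + 1) (boxEquiv i.hN x).1 → x ∈ Q c) →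
      (∀ c, ∀ (κ : Fin (d + 1)) (x : Site (PV d ℓ i.m i.K hd hL) 0), x ∈ Q c → x.shift κ ∈ Q c →
        gaugeY i (u c) U κ x = fluct (kGeo i).eta (A c) κ x) →
      (∀ c, ∀ κ, ∀ x ∈ Q c, ‖A c κ x‖ ≤ C c * (ξ c)⁻¹) →
      (∀ c, ∀ μ ν, ∀ x ∈ Q c, ‖(((kGeo i).eta : ℂ)⁻¹) • covD (shiftsV1 (PV d ℓ i.m i.K hd hL)) (fun _ _ => (1 : 𝔸ˣ)) μ (A c ν) x‖ ≤ C c * (ξ c ^ 2)⁻¹) →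
      (∀ c, max (C c) (C c * (1 + D1 thetaProf)) * Λ c ^ 2 ≤ a₁) → (∀ c, max (C c) (C c * (1 + D1 thetaProf)) * Λ c ^ 2 ≤ 1 / 4) →
    ∀ {B : B9.Backgrounds} (cfg : B.Cfg → CfgY 𝔸 i) (par : BondParY 𝔸 i) (U₁ : B.Cfg), cfg U₁ = U →
    ∀ (_ : EBlock (kernelFamilySInv i B cfg (fun W => GpY i (parSymY i) W) (parSymY i)) BG δG U₁)
      (Oc : ↥(cubes i.D.toDomains) → BondOpY 𝔸 i) (_ : ∀ c : ↥(cubes i.D.toDomains), EBlock (kernelFamilyBInv i B cfg (Oc c) par) BO δO U₁)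
      (ιB : BlkY i → IBondY i) (_ : ∀ s, β i.hN i.D i.hk (ιB s) = s)
      (_ : ∀ z w : SiteY i, ‖(parSymY i (cfg U₁) z w : 𝔸)‖ ≤ 1 ∧ ‖(((parSymY i (cfg U₁) z w)⁻¹ : 𝔸ˣ) : 𝔸)‖ ≤ 1)
      (_ : HasMajorant (g := toB6 (geo9K i) (Rr i) (Hp i)) (fun q : BlkY i × ι => ιB q.1)
        (conj b (((etaS i ^ 2 * etaS i ^ 2)⁻¹) • (XinvY i (parSymY i) (fun W => GpY i (parSymY i) W) (cfg U₁)).restrictScalars ℝ))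
        (fun a a' => B₁ * ((geo9K i).len a ^ 4)⁻¹ * Real.exp (-(δX * (geo9K i).dist a a'))))
      (_ : IsUnit (deltaPrimeAY i (parSymY i) (cfg U₁)))
      (_ : IsUnit (XY i (parSymY i) (fun W => GpY i (parSymY i) W) (cfg U₁)))
      (_ : ∀ (c : ↥(cubes i.D.toDomains)) (z w : SiteY i),
        ‖(parSymY i (gaugeY i (u c)⁻¹ (locCfgY i c (kGeo i).eta (A c))) z w : 𝔸)‖ ≤ 1 ∧
          ‖(((parSymY i (gaugeY i (u c)⁻¹ (locCfgY i c (kGeo i).eta (A c))) z w)⁻¹ : 𝔸ˣ) : 𝔸)‖ ≤ 1),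
    HasMajorant (g := toB6 (geo9K i) (Rr i) (Hp i)) (fun p : FBondY i × ι => ιB (blkV1 i.hN i.D p.1))
      (∑ c : ↥(cubes i.D.toDomains), conj b ((cutMulY (𝔸 := 𝔸) (hBdY i (hTY i c)) * Oc c (cfg U₁) * cutMulY (𝔸 := 𝔸) (hBdY i (hTY i c)) *
        (cutMulY (𝔸 := 𝔸) (hBdY i (zetaY i c)) *
          (DPDsY i (parSymY i) (fun W => GpY i (parSymY i) W) (cfg U₁) -
            locProjBY i c (parSymY i) (u c) (locCfgY i c (kGeo i).eta (A c))))).restrictScalars ℝ))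
      (fun a a' => Θ₃ * Real.exp (-(κ₃ * ((toKT i).Mh : ℝ))) * Real.exp (-(ρ₃ * (geo9K i).dist a a'))) := by
  classical
  have hL1 : (1 : ℝ) ≤ (ℓ : ℝ) + 1 := by linarith [(Nat.cast_nonneg ℓ : (0 : ℝ) ≤ ℓ)]
  have hL0 : (0 : ℝ) < (ℓ : ℝ) + 1 := by positivity
  have hlog : 0 ≤ Real.log ((ℓ : ℝ) + 1) := Real.log_nonneg hL1
  have h2L : (0 : ℝ) < 2 * ((ℓ : ℝ) + 1) ^ 2 - 1 := by nlinarith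
  have hSb : 0 ≤ ∑ j, ‖b j‖ := Finset.sum_nonneg fun _ _ => norm_nonneg _
  have hS : 0 ≤ M₂ * ∑ j, ‖b j‖ := mul_nonneg hM₂ hSb
  have hD1 : 0 ≤ D1 thetaProf := D1_nonneg contDiff_thetaProf hasCompactSupport_thetaProf
  have hCq : 0 ≤ Cq d := Cq_nonneg d
  -- ═══ the four per-cube ∃-packages (the fourth is the hV′-only cube datum `hPlC`) ═══
  obtain ⟨δQ, KQ, M₀Q, T₀Q, N₀Q, dBQ, hδQ, hKQ, a₁Q, ha₁Q, HQ⟩ := plC_at_datum (hd := hd) (hL := hL) (b₀ := b₀) (b₁ := b₁) b hℓ M₂ hM₂ hrepr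
  obtain ⟨δS, θS, M₀S, T₀S, N₀S, hδS, hθS, a₁S, ha₁S, HS⟩ := commSteps_at_datum b d ℓ hℓ hM₂ hrepr
  obtain ⟨δC, BC, M₀C, T₀C, N₀C, hδC, hBC, a₁C, ha₁C, HC⟩ := cinv_cube_at_locCfg b d ℓ hℓ M₂ hM₂ hrepr
  obtain ⟨δB, Bf, M₀B, T₀B, N₀B, hδB, hBf, a₁B, ha₁B, HB⟩ := gp_cube_entries_at_locCfg b d ℓ hℓ M₂ hM₂ hrepr
  -- ═══ the unit rate `m` ═══
  obtain ⟨m, hmdef⟩ : ∃ m : ℝ, m = min δG (min δX (min δO (min δS (min δC (min δB δQ))))) := ⟨_, rfl⟩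
  have hm : 0 < m := by rw [hmdef]; exact lt_min hδG (lt_min hδX (lt_min hδO (lt_min hδS (lt_min hδC (lt_min hδB hδQ)))))
  have hmG : m ≤ δG := by rw [hmdef]; exact min_le_left _ _
  have hmX : m ≤ δX := by rw [hmdef]; exact (min_le_right _ _).trans (min_le_left _ _)
  have hmO : m ≤ δO := by rw [hmdef]; exact ((min_le_right _ _).trans (min_le_right _ _)).trans (min_le_left _ _)
  have hmS : m ≤ δS := by
    rw [hmdef]; exact (((min_le_right _ _).trans (min_le_right _ _)).trans (min_le_right _ _)).trans (min_le_left _ _)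
  have hmC : m ≤ δC := by
    rw [hmdef]
    exact ((((min_le_right _ _).trans (min_le_right _ _)).trans (min_le_right _ _)).trans (min_le_right _ _)).trans (min_le_left _ _)
  have hmB : m ≤ δB := by
    rw [hmdef]
    exact (((((min_le_right _ _).trans (min_le_right _ _)).trans (min_le_right _ _)).trans (min_le_right _ _)).trans (min_le_right _ _)).trans
      (min_le_left _ _)
  have hmQ : m ≤ δQ := by
    rw [hmdef]
    exact (((((min_le_right _ _).trans (min_le_right _ _)).trans (min_le_right _ _)).trans (min_le_right _ _)).trans (min_le_right _ _)).trans
      (min_le_right _ _)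
  -- ═══ the cube (2.61)s ═══
  obtain ⟨dBS, h261S⟩ := exists_h261_geoCK d ℓ hδS
  obtain ⟨dBCc, h261Cc⟩ := exists_h261_geoCK d ℓ hδC
  obtain ⟨dBBc, h261Bc⟩ := exists_h261_geoCK d ℓ hδB
  -- ═══ the member (2.61)s: six rate pairs ═══
  obtain ⟨r', hr'def⟩ : ∃ r' : ℝ, r' = 1 / 16 * m / δO := ⟨_, rfl⟩
  have hr' : 0 < r' := by rw [hr'def]; positivity
  have hr'1 : r' ≤ 1 / 16 := by
    rw [hr'def, div_le_iff₀ hδO]; linarith only [hmO]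
  obtain ⟨ρ', hρ'def⟩ : ∃ ρ' : ℝ, ρ' = r' / 8 := ⟨_, rfl⟩
  have hρ' : 0 < ρ' := by rw [hρ'def]; positivity
  have hρ'2 : ρ' ≤ 1 / 2 := by rw [hρ'def]; linarith only [hr'1]
  have hp₁ : 0 < 1 / 8 * (1 / 8 * m) := by positivity
  have hp₂ : 0 < (m / (4 * δG) - m / (8 * δG)) * δG := by
    have : (m / (4 * δG) - m / (8 * δG)) * δG = m / 8 := by field_simp; ring
    rw [this]; positivity
  have hp₃ : 0 < (1 - 1 / 8 - 1 / 8 - 1 / 8) * m := by positivity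
  have hp₄ : 0 < 1 / 256 * m := by positivity
  have hp₅ : 0 < (r' / 4 - ρ') * δO := mul_pos (by rw [hρ'def]; linarith only [hr']) hδO
  have hp₆ : 0 < 1 / 32 * m := by positivity
  obtain ⟨ML₁, hgeo₁⟩ := ineq261_three_geo9K Rr Hp hp₁ hp₂ hp₃
  obtain ⟨ML₂, hgeo₂⟩ := ineq261_three_geo9K Rr Hp hp₄ hp₅ hp₆
  set e11 : ℕ := exp261 (geo9K (d := d) (ℓ := ℓ) (hd := hd) (hL := hL) (b₀ := b₀) (b₁ := b₁)) (1 / 8 * m) (1 / 8) with he11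
  set e12 : ℕ := max (exp261 (geo9K (d := d) (ℓ := ℓ) (hd := hd) (hL := hL) (b₀ := b₀) (b₁ := b₁)) δG (m / (4 * δG) - m / (8 * δG)))
    (exp261 (geo9K (d := d) (ℓ := ℓ) (hd := hd) (hL := hL) (b₀ := b₀) (b₁ := b₁)) m (1 - 1 / 8 - 1 / 8 - 1 / 8)) with he12
  set e21 : ℕ := exp261 (geo9K (d := d) (ℓ := ℓ) (hd := hd) (hL := hL) (b₀ := b₀) (b₁ := b₁)) m (1 / 256) with he21
  set e22 : ℕ := max (exp261 (geo9K (d := d) (ℓ := ℓ) (hd := hd) (hL := hL) (b₀ := b₀) (b₁ := b₁)) δO (r' / 4 - ρ'))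
    (exp261 (geo9K (d := d) (ℓ := ℓ) (hd := hd) (hL := hL) (b₀ := b₀) (b₁ := b₁)) m (1 / 32)) with he22
  have hcS : 0 ≤ B6.c1 dBS δS (1 / 2) := c1_nonneg _ _ _
  have hcCc : 0 ≤ B6.c1 dBCc δC (1 / 2) := c1_nonneg _ _ _
  have hcBc : 0 ≤ B6.c1 dBBc δB (1 / 2) := c1_nonneg _ _ _
  have hc11 : 0 ≤ B6.c1 e11 (1 / 8 * m) (1 / 8) := c1_nonneg _ _ _
  have hc12G : 0 ≤ B6.c1 e12 δG (m / (4 * δG) - m / (8 * δG)) := c1_nonneg _ _ _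
  have hc12m : 0 ≤ B6.c1 e12 m (1 - 1 / 8 - 1 / 8 - 1 / 8) := c1_nonneg _ _ _
  have hc21 : 0 ≤ B6.c1 e21 m (1 / 256) := c1_nonneg _ _ _
  have hc22O : 0 ≤ B6.c1 e22 δO (r' / 4 - ρ') := c1_nonneg _ _ _
  have hcQ : 0 ≤ B6.c1 dBQ δQ (1 / 2) := c1_nonneg _ _ _
  have hκ349 : 0 ≤ kappa349 (M₂ * ∑ j, ‖b j‖) (((d : ℝ) + 1) * (M₂ * (∑ j, ‖b j‖) * BG)) B₁ (((ℓ : ℝ) + 1) ^ 4) (B6.c1 e11 (1 / 8 * m) (1 / 8)) := by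
    unfold kappa349; positivity
  have hc22t : 0 ≤ B6.c1 e22 m (1 / 32) := c1_nonneg _ _ _
  -- ═══ the member-independent constants (opaque names with defining equations) ═══
  obtain ⟨BS, hBSdef⟩ : ∃ x : ℝ, x = ((M₂ * ∑ j, ‖b j‖) * (1 + Cq d * (1 / 4))) ^ 2 * BC := ⟨_, rfl⟩
  have hBS : 0 ≤ BS := by rw [hBSdef]; positivity
  have hθK : 0 ≤ (M₂ * ∑ j, ‖b j‖) ^ 2 * (θS * B6.c1 dBS δS (1 / 2)) := by positivity
  obtain ⟨κL, hκLdef⟩ : ∃ x : ℝ, x = (M₂ * ∑ j, ‖b j‖) * BG * (1 + D1 thetaProf / 3) * (1 + (M₂ * ∑ j, ‖b j‖) ^ 2 * (θS * B6.c1 dBS δS (1 / 2)) * B6.c1 e22 m (1 / 32)) := ⟨_, rfl⟩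
  have hκL : 0 ≤ κL := by rw [hκLdef]; positivity
  obtain ⟨κR, hκRdef⟩ : ∃ x : ℝ, x = ((M₂ * ∑ j, ‖b j‖) * BG + (M₂ * ∑ j, ‖b j‖) * BG * ((ℓ : ℝ) + 1) * (D1 thetaProf / 3)) * (1 + (M₂ * ∑ j, ‖b j‖) ^ 2 * (θS * B6.c1 dBS δS (1 / 2)) * ((ℓ : ℝ) + 1) * B6.c1 e22 m (1 / 32)) := ⟨_, rfl⟩
  have hκR : 0 ≤ κR := by rw [hκRdef]; positivity
  obtain ⟨κT0, hκT0def⟩ : ∃ x : ℝ, x = (M₂ * ∑ j, ‖b j‖) ^ 2 * (BS * ((ℓ : ℝ) + 1) ^ 4) * ((ℓ : ℝ) + 1) ^ 4 * κR * ((ℓ : ℝ) + 1) * B6.c1 e22 m (1 / 32) := ⟨_, rfl⟩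
  have hκT0 : 0 ≤ κT0 := by rw [hκT0def]; positivity
  obtain ⟨κT1, hκT1def⟩ : ∃ x : ℝ, x = (M₂ * ∑ j, ‖b j‖) ^ 2 * (Bf * B6.c1 dBBc δB (1 / 2)) * κT0 * ((ℓ : ℝ) + 1) ^ 3 * B6.c1 e22 m (1 / 32) := ⟨_, rfl⟩
  have hκT1 : 0 ≤ κT1 := by rw [hκT1def]; positivity
  obtain ⟨κT2, hκT2def⟩ : ∃ x : ℝ, x = (M₂ * ∑ j, ‖b j‖) ^ 2 * (Bf * B6.c1 dBBc δB (1 / 2)) * ((M₂ * ∑ j, ‖b j‖) ^ 2 * (Bf * B6.c1 dBBc δB (1 / 2))) * ((ℓ : ℝ) + 1) ^ 2 * B6.c1 e22 m (1 / 32) * κT0 * ((ℓ : ℝ) + 1) ^ 3 * B6.c1 e22 m (1 / 32) := ⟨_, rfl⟩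
  have hκT2 : 0 ≤ κT2 := by rw [hκT2def]; positivity
  obtain ⟨κSb, hκSbdef⟩ : ∃ x : ℝ, x = (M₂ * ∑ j, ‖b j‖) ^ 2 * (BS * B6.c1 dBCc δC (1 / 2)) := ⟨_, rfl⟩
  have hκSb : 0 ≤ κSb := by rw [hκSbdef]; positivity
  obtain ⟨κK, hκKdef⟩ : ∃ x : ℝ, x = (M₂ * ∑ j, ‖b j‖) ^ 2 * ((BS * θS * 1 * B6.c1 dBCc δC (1 / 2)) * ((ℓ : ℝ) + 1) ^ 4) * ((ℓ : ℝ) + 1) ^ 4 := ⟨_, rfl⟩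
  have hκK : 0 ≤ κK := by rw [hκKdef]; positivity
  obtain ⟨κG, hκGdef⟩ : ∃ x : ℝ, x = ((M₂ * ∑ j, ‖b j‖) ^ 2 * (BS * ((ℓ : ℝ) + 1) ^ 4) * ((ℓ : ℝ) + 1) ^ 4 + κK) * ((M₂ * ∑ j, ‖b j‖) * BG + (M₂ * ∑ j, ‖b j‖) * BG * ((ℓ : ℝ) + 1) * (D1 thetaProf / 3)) * ((ℓ : ℝ) + 1) * B6.c1 e22 m (1 / 32) := ⟨_, rfl⟩
  have hκG : 0 ≤ κG := by rw [hκGdef]; positivity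
  have hκPb : 0 ≤ (M₂ * ∑ j, ‖b j‖) ^ 2 := by positivity
  -- the collar-free budget constants (collar factors replaced by `1`)
  obtain ⟨εT1, hεT1def⟩ : ∃ x : ℝ, x = ((M₂ * ∑ j, ‖b j‖) * BG * (1 + D1 thetaProf / 3)) * (1 + ((M₂ * ∑ j, ‖b j‖) ^ 2 * (θS * B6.c1 dBS δS (1 / 2))) * B6.c1 e12 δG (m / (4 * δG) - m / (8 * δG)) * 1) + ((M₂ * ∑ j, ‖b j‖) * BG * (1 + ((ℓ : ℝ) + 1) * (D1 thetaProf / 3))) * (1 + ((M₂ * ∑ j, ‖b j‖) ^ 2 * (θS * B6.c1 dBS δS (1 / 2))) * ((ℓ : ℝ) + 1) * B6.c1 e12 m (1 - 1 / 8 - 1 / 8 - 1 / 8) * 1) := ⟨_, rfl⟩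
  have hεT1 : 0 ≤ εT1 := by rw [hεT1def]; positivity
  obtain ⟨ε31, hε31def⟩ : ∃ x : ℝ, x = ((d : ℝ) + 1) * (κL * ((M₂ * ∑ j, ‖b j‖) ^ 2 * B₁) * (M₂ * ∑ j, ‖b j‖) ^ 2 * κT2 * (((ℓ : ℝ) + 1) ^ 4 * ((ℓ : ℝ) + 1)) * B6.c1 e21 m (1 / 256) ^ 2 * 1 + κL * ((M₂ * ∑ j, ‖b j‖) ^ 2 * B₁) * (M₂ * (∑ j, ‖b j‖) * BG) ^ 2 * (M₂ * ∑ j, ‖b j‖) ^ 2 * κT0 * (((ℓ : ℝ) + 1) ^ 4 * (((ℓ : ℝ) + 1) ^ 2) ^ 2 * ((ℓ : ℝ) + 1) ^ 3) * B6.c1 e21 m (1 / 256) ^ 4 * 1 + κL * ((M₂ * ∑ j, ‖b j‖) ^ 2 * B₁) * (M₂ * (∑ j, ‖b j‖) * BG) ^ 2 * ((M₂ * ∑ j, ‖b j‖) ^ 2 * (θS * B6.c1 dBS δS (1 / 2))) * κT0 * (((ℓ : ℝ) + 1) ^ 4 * (((ℓ : ℝ) + 1) ^ 2) ^ 2 *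 ((ℓ : ℝ) + 1) ^ 3) * B6.c1 e21 m (1 / 256) ^ 5 * 1 + κL * ((M₂ * ∑ j, ‖b j‖) ^ 2 * B₁) * (M₂ * (∑ j, ‖b j‖) * BG) * ((M₂ * ∑ j, ‖b j‖) ^ 2 * (θS * B6.c1 dBS δS (1 / 2))) * κT1 * (((ℓ : ℝ) + 1) ^ 4 * ((ℓ : ℝ) + 1) ^ 2 * ((ℓ : ℝ) + 1)) * B6.c1 e21 m (1 / 256) ^ 4 * 1 + κL * ((M₂ * ∑ j, ‖b j‖) ^ 2 * B₁) * κR * (((ℓ : ℝ) + 1) ^ 4 * ((ℓ : ℝ) + 1)) * B6.c1 e21 m (1 / 256) ^ 2 * 1 + κL * κSb * κR * (((ℓ : ℝ) + 1) ^ 4 * ((ℓ : ℝ) + 1)) * B6.c1 e21 m (1 / 256) ^ 2 * 1 + κL * 1 * (((M₂ * ∑ j, ‖b j‖) ^ 2 * B₁) * κR * ((ℓ : ℝ) + 1) * B6.c1 e21 m (1 / 256)) * ((ℓ : ℝ) + 1) ^ 3 * B6.c1 e21 m (1 / 256) + κL * 1 * κG * ((ℓ : ℝ) + 1) ^ 3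 * B6.c1 e21 m (1 / 256)) := ⟨_, rfl⟩
  have hε31 : 0 ≤ ε31 := by rw [hε31def]; positivity
  obtain ⟨Θ₃, hΘ₃def⟩ : ∃ x : ℝ, x = (3 * 5 ^ (d + 1)) * (((M₂ * (∑ j, ‖b j‖) * BO) *
      (((M₂ * ∑ j, ‖b j‖) * (M₂ * ∑ j, ‖b j‖) * B₁ * (((ℓ : ℝ) + 1) ^ 4) ^ 4 * B6.c1 e11 (1 / 8 * m) (1 / 8) ^ 2 * (((d : ℝ) + 1) * εT1 * (2 * ((M₂ * ∑ j, ‖b j‖) * BG) + εT1)) + ε31) * Real.exp (3 / 128 * m * 3) +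
        (kappa349 (M₂ * ∑ j, ‖b j‖) (((d : ℝ) + 1) * (M₂ * (∑ j, ‖b j‖) * BG)) B₁ (((ℓ : ℝ) + 1) ^ 4) (B6.c1 e11 (1 / 8 * m) (1 / 8)) + (M₂ * ∑ j, ‖b j‖) ^ 2 * (KQ * B6.c1 dBQ δQ (1 / 2))))) * ((ℓ : ℝ) + 1) ^ 2 * B6.c1 e22 δO (r' / 4 - ρ')) := ⟨_, rfl⟩
  have hΘ₃ : 0 ≤ Θ₃ := by rw [hΘ₃def]; positivity
  -- ═══ the package ═══
  refine ⟨ρ' * δO, m / 64 / (2 * ((ℓ : ℝ) + 1)), Θ₃,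
    max (max (max M₀S (max M₀C M₀B)) (max ML₁ (max ML₂ (1024 * Real.log ((ℓ : ℝ) + 1) / (m * (2 * ((ℓ : ℝ) + 1) ^ 2 - 1)))))) M₀Q,
    max (max (max T₀S (max T₀C T₀B)) (4 * Real.log ((ℓ : ℝ) + 1) / (9 / 5000 * (m / 2)))) T₀Q,
    max (max (max N₀S (max N₀C N₀B)) (max (N1 d ℓ (9 / 5000 * δS)) (max (N1 d ℓ (9 / 5000 * δC)) (N1 d ℓ (9 / 5000 * δB))))) N₀Q,
    by positivity, by positivity, hΘ₃, min (min a₁S (min a₁C a₁B)) a₁Q, lt_min (lt_min ha₁S (lt_min ha₁C ha₁B)) ha₁Q, ?_⟩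
  intro i hM' hN' hT' hcf U u hu A Q C ξ Λ hC0 hξ hΛ hξS hΛξ hQ hgA hAb hdA hs₁' hs₄ B cfg par U₁ hcfg hE Oc hEO ιB hι hpar hCinv hU hX hparV
  subst hcfg
  -- the fourth package's thresholds split off first; the rest is p33's P3 threading verbatim
  have hM := (le_max_left _ _).trans hM'
  have hMQ : M₀Q ≤ ((ℓ : ℝ) + 1) * (toKT i).Mh := (le_max_right _ _).trans hM'
  have hT := (le_max_left _ _).trans hT'
  have hTQ : T₀Q ≤ RM1 i := (le_max_right _ _).trans hT'
  have hN := le_trans (Nat.succ_le_succ (le_max_left _ _)) hN'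
  have hNQ : N₀Q + 1 ≤ (toKT i).R * ((ℓ + 1) * (toKT i).Mh) := le_trans (Nat.succ_le_succ (le_max_right _ _)) hN'
  have hs₁ : ∀ c, max (C c) (C c * (1 + D1 thetaProf)) * Λ c ^ 2 ≤ min a₁S (min a₁C a₁B) := fun c => (hs₁' c).trans (min_le_left _ _)
  have ha₁Q : ∀ c, max (C c) (C c * (1 + D1 thetaProf)) * Λ c ^ 2 ≤ a₁Q := fun c => (hs₁' c).trans (min_le_right _ _)
  -- ─── thresholds ───
  have hMg : (geo9K i).M = ((ℓ : ℝ) + 1) * ((toKT i).Mh : ℝ) := by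
    show (((ℓ + 1 : ℕ) : ℝ)) * (i.Mh : ℝ) = ((ℓ : ℝ) + 1) * ((i.Mh : ℕ) : ℝ); push_cast; ring
  have hMS : M₀S ≤ ((ℓ : ℝ) + 1) * (toKT i).Mh := ((le_max_left _ _).trans (le_max_left _ _)).trans hM
  have hMC : M₀C ≤ ((ℓ : ℝ) + 1) * (toKT i).Mh := (((le_max_left _ _).trans (le_max_right _ _)).trans (le_max_left _ _)).trans hM
  have hMB : M₀B ≤ ((ℓ : ℝ) + 1) * (toKT i).Mh := (((le_max_right _ _).trans (le_max_right _ _)).trans (le_max_left _ _)).trans hM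
  have hML₁ : ML₁ ≤ (geo9K i).M := by rw [hMg]; exact ((le_max_left _ _).trans (le_max_right _ _)).trans hM
  have hML₂ : ML₂ ≤ (geo9K i).M := by rw [hMg]; exact (((le_max_left _ _).trans (le_max_right _ _)).trans (le_max_right _ _)).trans hM
  have hMT : 1024 * Real.log ((ℓ : ℝ) + 1) / (m * (2 * ((ℓ : ℝ) + 1) ^ 2 - 1)) ≤ (geo9K i).M := by
    rw [hMg]; exact (((le_max_right _ _).trans (le_max_right _ _)).trans (le_max_right _ _)).trans hM
  have hMT' : 1024 * Real.log ((ℓ : ℝ) + 1) ≤ m * (2 * ((ℓ : ℝ) + 1) ^ 2 - 1) * (geo9K i).M := by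
    rw [div_le_iff₀ (by positivity)] at hMT; linarith only [hMT]
  have hTS : T₀S ≤ RM1 i := ((le_max_left _ _).trans (le_max_left _ _)).trans hT
  have hTC : T₀C ≤ RM1 i := (((le_max_left _ _).trans (le_max_right _ _)).trans (le_max_left _ _)).trans hT
  have hTB : T₀B ≤ RM1 i := (((le_max_right _ _).trans (le_max_right _ _)).trans (le_max_left _ _)).trans hT
  have hTK : 4 * Real.log ((ℓ : ℝ) + 1) / (9 / 5000 * (m / 2)) ≤ RM1 i := (le_max_right _ _).trans hT
  have hNS : N₀S + 1 ≤ (toKT i).R * ((ℓ + 1) * (toKT i).Mh) := le_trans (Nat.succ_le_succ ((le_max_left _ _).trans (le_max_left _ _))) hN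
  have hNC : N₀C + 1 ≤ (toKT i).R * ((ℓ + 1) * (toKT i).Mh) :=
    le_trans (Nat.succ_le_succ (((le_max_left _ _).trans (le_max_right _ _)).trans (le_max_left _ _))) hN
  have hNB : N₀B + 1 ≤ (toKT i).R * ((ℓ + 1) * (toKT i).Mh) :=
    le_trans (Nat.succ_le_succ (((le_max_right _ _).trans (le_max_right _ _)).trans (le_max_left _ _))) hN
  have hN₁ : N1 d ℓ (9 / 5000 * δS) + 1 ≤ (toKT i).R * ((ℓ + 1) * (toKT i).Mh) :=
    le_trans (Nat.succ_le_succ ((le_max_left _ _).trans (le_max_right _ _))) hN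
  have hN₂ : N1 d ℓ (9 / 5000 * δC) + 1 ≤ (toKT i).R * ((ℓ + 1) * (toKT i).Mh) :=
    le_trans (Nat.succ_le_succ (((le_max_left _ _).trans (le_max_right _ _)).trans (le_max_right _ _))) hN
  have hN₃ : N1 d ℓ (9 / 5000 * δB) + 1 ≤ (toKT i).R * ((ℓ + 1) * (toKT i).Mh) :=
    le_trans (Nat.succ_le_succ (((le_max_right _ _).trans (le_max_right _ _)).trans (le_max_right _ _))) hN
  have ha₁S : ∀ c, max (C c) (C c * (1 + D1 thetaProf)) * Λ c ^ 2 ≤ a₁S := fun c => (hs₁ c).trans (min_le_left _ _)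
  have ha₁C : ∀ c, max (C c) (C c * (1 + D1 thetaProf)) * Λ c ^ 2 ≤ a₁C := fun c => (hs₁ c).trans ((min_le_right _ _).trans (min_le_left _ _))
  have ha₁B : ∀ c, max (C c) (C c * (1 + D1 thetaProf)) * Λ c ^ 2 ≤ a₁B := fun c => (hs₁ c).trans ((min_le_right _ _).trans (min_le_right _ _))
  have hMh8 : (8 : ℝ) ≤ (i.Mh : ℝ) := by exact_mod_cast i.hM8
  -- ─── units ───
  have hetaS : etaS i = (kGeo i).eta := B9Cor36GpCoverBindersUnitary.etaS_eq_kGeo_eta_of_cf i hcf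
  have hη : etaS i = |i.cf|⁻¹ := by have h := hetaS; exact h
  have hη0 : 0 < etaS i := B9Ineq349SiteComposite.etaS_pos i
  have hs : (etaS i ^ 2 * etaS i ^ 2) * (etaS i ^ 2 * etaS i ^ 2)⁻¹ = 1 := mul_inv_cancel₀ (by positivity)
  have hs4 : ((kGeo i).eta ^ 4)⁻¹ = (etaS i ^ 2 * etaS i ^ 2)⁻¹ := by rw [hetaS]; ring
  -- ─── the member geometry ───
  obtain ⟨h261_11, h261_12G, h261_12m⟩ := hgeo₁ i hML₁
  obtain ⟨h261_21, h261_22O, h261_22t⟩ := hgeo₂ i hML₂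
  have hl0 : ∀ a : (geo9K i).Site, 0 ≤ (geo9K i).len a := fun a => (geo9K_len_pos i a).le
  have hLpow : ∀ ⦃p q : ℕ⦄, p ≤ q → ((ℓ : ℝ) + 1) ^ p ≤ ((ℓ : ℝ) + 1) ^ q := fun p q h => pow_le_pow_right₀ hL1 h
  have hthr : ∀ ⦃c a : ℝ⦄, 0 ≤ c → c ≤ 4 → 1 / 256 * m ≤ a → c * Real.log ((ℓ : ℝ) + 1) ≤ a * (2 * ((ℓ : ℝ) + 1) ^ 2 - 1) * (geo9K i).M := by
    intro c a hc0 hc4 ha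
    have hM0 : 0 ≤ (geo9K i).M := by rw [hMg]; positivity
    have h1 : c * Real.log ((ℓ : ℝ) + 1) ≤ 4 * Real.log ((ℓ : ℝ) + 1) := mul_le_mul_of_nonneg_right hc4 hlog
    have h2 : 1 / 256 * m * ((2 * ((ℓ : ℝ) + 1) ^ 2 - 1) * (geo9K i).M) ≤ a * ((2 * ((ℓ : ℝ) + 1) ^ 2 - 1) * (geo9K i).M) :=
      mul_le_mul_of_nonneg_right ha (by positivity)
    have h3 : 1 / 256 * m * ((2 * ((ℓ : ℝ) + 1) ^ 2 - 1) * (geo9K i).M) = 1 / 256 * (m * (2 * ((ℓ : ℝ) + 1) ^ 2 - 1) * (geo9K i).M) := by ring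
    have h4 : a * ((2 * ((ℓ : ℝ) + 1) ^ 2 - 1) * (geo9K i).M) = a * (2 * ((ℓ : ℝ) + 1) ^ 2 - 1) * (geo9K i).M := by ring
    linarith only [h1, h2, h3, h4, hMT']
  -- main group `(m∕8, 1∕8)`: `ℓ`, `ℓ⁻⁴` with constant `L⁴`
  have hT1 : ScaleTransfer (geo9K i) (1 / 8 * m) (1 / 8) (((ℓ : ℝ) + 1) ^ 4) (fun a => (geo9K i).len a) :=
    scaleTransfer_mono_const hl0 ((pow_one _).symm.le.trans (hLpow (by norm_num))) (scaleTransfer_len_geo9K i hp₁ (by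
      have := hthr (c := 1) (a := 1 / 8 * (1 / 8 * m)) (by norm_num) (by norm_num) (by linarith only [hm.le]); linarith only [this]))
  have hT4 : ScaleTransfer (geo9K i) (1 / 8 * m) (1 / 8) (((ℓ : ℝ) + 1) ^ 4) (fun a => ((geo9K i).len a ^ 4)⁻¹) :=
    scaleTransfer_len_inv4_geo9K i hp₁ (hthr (by norm_num) (by norm_num) (by linarith only [hm.le]))
  -- hV′-only: the `ℓ²` transfer of the transposed record at the main group, constant `L²` weakened to `L⁴`
  have hT2 : ScaleTransfer (geo9K i) (1 / 8 * m) (1 / 8) (((ℓ : ℝ) + 1) ^ 4) (fun a => (geo9K i).len a ^ 2) :=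
    scaleTransfer_mono_const (fun a => pow_nonneg (hl0 a) 2) (hLpow (by norm_num)) (scaleTransfer_len_sq_geo9K i hp₁
      (hthr (by norm_num) (by norm_num) (by linarith only [hm.le])))
  -- E3 group `(m, 1∕8)` and `(m, 1∕4)`: `ℓ` with constant `L`
  have hT13 : ScaleTransfer (geo9K i) m (1 / 8) ((ℓ : ℝ) + 1) (fun a => (geo9K i).len a) :=
    scaleTransfer_len_geo9K i (by positivity) (by
      have := hthr (c := 1) (a := 1 / 8 * m) (by norm_num) (by norm_num) (by linarith only [hm.le]); linarith only [this])
  have hTst : ScaleTransfer (geo9K i) m (1 / 4) ((ℓ : ℝ) + 1) (fun a => (geo9K i).len a) :=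
    scaleTransfer_len_geo9K i (by positivity) (by
      have := hthr (c := 1) (a := 1 / 4 * m) (by norm_num) (by norm_num) (by linarith only [hm.le]); linarith only [this])
  -- w group `(m, 1∕256)`: `ℓ⁻⁴`, `ℓ²`, `ℓ⁻³`, `ℓ⁻¹`, `ℓ`
  have hST4w : ScaleTransfer (geo9K i) m (1 / 256) (((ℓ : ℝ) + 1) ^ 4) (fun a => ((geo9K i).len a ^ 4)⁻¹) :=
    scaleTransfer_len_inv4_geo9K i hp₄ (hthr (by norm_num) (by norm_num) le_rfl)
  have hST2w : ScaleTransfer (geo9K i) m (1 / 256) (((ℓ : ℝ) + 1) ^ 2) (fun a => (geo9K i).len a ^ 2) :=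
    scaleTransfer_len_sq_geo9K i hp₄ (hthr (by norm_num) (by norm_num) le_rfl)
  have hST3w : ScaleTransfer (geo9K i) m (1 / 256) (((ℓ : ℝ) + 1) ^ 3) (fun a => ((geo9K i).len a ^ 3)⁻¹) :=
    scaleTransfer_len_inv_pow_geo9K i 3 hp₄ (by
      have := hthr (c := 3) (a := 1 / 256 * m) (by norm_num) (by norm_num) le_rfl; norm_num; linarith only [this])
  have hSTm1w : ScaleTransfer (geo9K i) m (1 / 256) ((ℓ : ℝ) + 1) (fun a => ((geo9K i).len a)⁻¹) := by
    have h := scaleTransfer_len_inv_pow_geo9K i 1 hp₄ (by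
      have := hthr (c := 1) (a := 1 / 256 * m) (by norm_num) (by norm_num) le_rfl; norm_num; linarith only [this])
    simpa only [pow_one] using h
  have hST1w : ScaleTransfer (geo9K i) m (1 / 256) ((ℓ : ℝ) + 1) (fun a => (geo9K i).len a) :=
    scaleTransfer_len_geo9K i hp₄ (by have := hthr (c := 1) (a := 1 / 256 * m) (by norm_num) (by norm_num) le_rfl; linarith only [this])
  -- tails group `(m, 1∕32)`: `ℓ`, `ℓ⁻⁴`, `ℓ⁻³`, `ℓ²`
  have hST1t : ScaleTransfer (geo9K i) m (1 / 32) ((ℓ : ℝ) + 1) (fun a => (geo9K i).len a) :=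
    scaleTransfer_len_geo9K i hp₆ (by
      have := hthr (c := 1) (a := 1 / 32 * m) (by norm_num) (by norm_num) (by linarith only [hm.le]); linarith only [this])
  have hST4t : ScaleTransfer (geo9K i) m (1 / 32) (((ℓ : ℝ) + 1) ^ 4) (fun a => ((geo9K i).len a ^ 4)⁻¹) :=
    scaleTransfer_len_inv4_geo9K i hp₆ (hthr (by norm_num) (by norm_num) (by linarith only [hm.le]))
  have hST3t : ScaleTransfer (geo9K i) m (1 / 32) (((ℓ : ℝ) + 1) ^ 3) (fun a => ((geo9K i).len a ^ 3)⁻¹) :=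
    scaleTransfer_len_inv_pow_geo9K i 3 hp₆ (by
      have := hthr (c := 3) (a := 1 / 32 * m) (by norm_num) (by norm_num) (by linarith only [hm.le]); norm_num; linarith only [this])
  have hST2t : ScaleTransfer (geo9K i) m (1 / 32) (((ℓ : ℝ) + 1) ^ 2) (fun a => (geo9K i).len a ^ 2) :=
    scaleTransfer_len_sq_geo9K i hp₆ (hthr (by norm_num) (by norm_num) (by linarith only [hm.le]))
  -- last group `(δ_O, ½)`: `ℓ⁻²` (the transposed record's final transfer)
  have hSTO : ScaleTransfer (geo9K i) δO (1 / 2) (((ℓ : ℝ) + 1) ^ 2) (fun a => ((geo9K i).len a ^ 2)⁻¹) :=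
    scaleTransfer_len_inv_pow_geo9K i 2 (by positivity) (by
      have := hthr (c := 2) (a := 1 / 2 * δO) (by norm_num) (by norm_num) (by linarith only [hmO, hm.le]); norm_num; linarith only [this])
  -- ─── the cube-side data at this member ───
  have HSc := fun c : ↥(cubes (toKT i).D.toDomains) => HS i c (Rr i) (Hp i) hMS hNS hTS (u c) (cfg U₁) (A c) (Q c) (C c) (ξ c) (Λ c)
    (hC0 c) (hξ c) (hΛ c) (hξS c) (hΛξ c) (hQ c) (hgA c) (hAb c) (hdA c) (ha₁S c) (hs₄ c)
  have HCc := fun c : ↥(cubes (toKT i).D.toDomains) => HC i c (Rr i) (Hp i) hMC hNC hTC (A c) (Q c) (C c) (ξ c) (Λ c)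
    (hC0 c) (hξ c) (hΛ c) (hξS c) (hΛξ c) (hQ c) (hAb c) (hdA c) (ha₁C c) (hs₄ c)
  have HBc := fun c : ↥(cubes (toKT i).D.toDomains) => HB i c (Rr i) (Hp i) hMB hNB hTB (u c) (cfg U₁) (A c) (Q c) (C c) (ξ c) (Λ c)
    (hC0 c) (hξ c) (hΛ c) (hξS c) (hΛξ c) (hQ c) (hgA c) (hAb c) (hdA c) (ha₁B c) (hs₄ c)
  have HQc := fun c : ↥(cubes (toKT i).D.toDomains) => HQ i c (Rr i) (Hp i) hMQ hNQ hTQ (A c) (Q c) (C c) (ξ c) (Λ c)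
    (hC0 c) (hξ c) (hΛ c) (hξS c) (hΛξ c) (hQ c) (hAb c) (hdA c) (ha₁Q c)
  have h261Qc : ∀ c : ↥(cubes (toKT i).D.toDomains), Ineq261 dBQ (toB6 (geoCK i c) (Rr i) (Hp i)) δQ (1 / 2) := fun c => (HQc c).1
  have hPlQ : ∀ c : ↥(cubes (toKT i).D.toDomains), HasMajorant (g := toB6 (geoCK i c) (Rr i) (Hp i)) (blkBK i c)
      (conj b ((DPDsCubeY i c (parSymY i) (locCfgY i c (kGeo i).eta (A c))).restrictScalars ℝ))
      (fun a y => KQ * ((geoCK i c).len a ^ 2)⁻¹ * Real.exp (-(δQ * (geoCK i c).dist a y))) := fun c => (HQc c).2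
  have h261Sc : ∀ c : ↥(cubes (toKT i).D.toDomains), Ineq261 dBS (toB6 (geoCK i c) (Rr i) (Hp i)) δS (1 / 2) :=
    fun c => h261S i c (Rr i) (Hp i) hN₁ _ (by norm_num) (by norm_num)
  have h261Cc' : ∀ c : ↥(cubes (toKT i).D.toDomains), Ineq261 dBCc (toB6 (geoCK i c) (Rr i) (Hp i)) δC (1 / 2) :=
    fun c => h261Cc i c (Rr i) (Hp i) hN₂ _ (by norm_num) (by norm_num)
  have h261Bc' : ∀ c : ↥(cubes (toKT i).D.toDomains), Ineq261 dBBc (toB6 (geoCK i c) (Rr i) (Hp i)) δB (1 / 2) :=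
    fun c => h261Bc i c (Rr i) (Hp i) hN₃ _ (by norm_num) (by norm_num)
  have hSTcK : ∀ c : ↥(cubes (toKT i).D.toDomains),
      ScaleTransfer (geoCK i c) (m / 2) (1 / 2) (((ℓ : ℝ) + 1) ^ 4) (fun a => ((geoCK i c).len a ^ 4)⁻¹) :=
    fun c => (hST_geoCK i c (half_pos hm) hTK (1 / 2) (by norm_num)).2.2.2.2.1
  -- units and letters per cube
  have hV : ∀ c : ↥(cubes (toKT i).D.toDomains),
      IsUnit (deltaPrimeACubeY i c (parSymY i) (gaugeY i (u c)⁻¹ (locCfgY i c (kGeo i).eta (A c)))) :=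
    fun c => isUnit_deltaPrimeACubeY_gauge_inv i c (parSymY_isGaugeLawS i) (u c) (HSc c).1
  have hXc : ∀ c : ↥(cubes (toKT i).D.toDomains),
      IsUnit (XCubeY i c (parSymY i) (gaugeY i (u c)⁻¹ (locCfgY i c (kGeo i).eta (A c)))) :=
    fun c => isUnit_XCubeY_gauge i c (u c)⁻¹ (HCc c).1.1
  have hR := fun c : ↥(cubes (toKT i).D.toDomains) => (HSc c).2.1
  have hTc := fun c : ↥(cubes (toKT i).D.toDomains) => (HSc c).2.2
  -- the cube resolvent `sS_□(Ṽ_□)` at the rate `δ_C`, constant `B_S`, and weakened to the rate `m∕2`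
  have hκQ : ∀ c : ↥(cubes (toKT i).D.toDomains), 0 ≤ (M₂ * ∑ j, ‖b j‖) * (1 + Cq d * (max (C c) (C c * (1 + D1 thetaProf)) * Λ c ^ 2)) :=
    fun c => mul_nonneg hS (add_nonneg zero_le_one (mul_nonneg hCq (mul_nonneg (le_max_of_le_left (hC0 c)) (sq_nonneg _))))
  have hdnnC := fun c : ↥(cubes (toKT i).D.toDomains) => (geoCK_dist_axioms i c (Rr i) (Hp i)).1
  have hScC : ∀ c : ↥(cubes (toKT i).D.toDomains), HasMajorant (g := toB6 (geoCK i c) (Rr i) (Hp i)) (fun p : SiteY i × ι => blkCubeY i c p.1)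
      (conj b ((((((etaS i ^ 2 * etaS i ^ 2)⁻¹ : ℝ) : ℂ)) • (QpsCubeY i c (parSymY i) (locCfgY i c (kGeo i).eta (A c)) ∘ₗ
        XinvCubeY i c (parSymY i) (locCfgY i c (kGeo i).eta (A c)) ∘ₗ QpCubeY i c (parSymY i) (locCfgY i c (kGeo i).eta (A c)))).restrictScalars ℝ))
      (fun a s => BS * ((geoCK i c).len a ^ 4)⁻¹ * Real.exp (-(δC * (geoCK i c).dist a s))) := by
    intro c
    obtain ⟨⟨-, hCi⟩, hQh, hQsh⟩ := HCc c
    rw [hs4] at hCi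
    have h := hasMajorant_resolventCube_of_cinv i c b (locCfgY i c (kGeo i).eta (A c)) ((etaS i ^ 2 * etaS i ^ 2)⁻¹) (hκQ c) hBC.le hQh hQsh hCi
    refine hasMajorant_mono (g := toB6 (geoCK i c) (Rr i) (Hp i)) _ h fun a s => ?_
    have hq1 : (M₂ * ∑ j, ‖b j‖) * (1 + Cq d * (max (C c) (C c * (1 + D1 thetaProf)) * Λ c ^ 2)) ≤ (M₂ * ∑ j, ‖b j‖) * (1 + Cq d * (1 / 4)) :=
      mul_le_mul_of_nonneg_left (by have := mul_le_mul_of_nonneg_left (hs₄ c) hCq; linarith only [this]) hS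
    have hsq : ((M₂ * ∑ j, ‖b j‖) * (1 + Cq d * (max (C c) (C c * (1 + D1 thetaProf)) * Λ c ^ 2))) ^ 2 ≤ ((M₂ * ∑ j, ‖b j‖) * (1 + Cq d * (1 / 4))) ^ 2 :=
      pow_le_pow_left₀ (hκQ c) hq1 2
    have hk : ((M₂ * ∑ j, ‖b j‖) * (1 + Cq d * (max (C c) (C c * (1 + D1 thetaProf)) * Λ c ^ 2))) ^ 2 * BC ≤ BS := by
      rw [hBSdef]; exact mul_le_mul_of_nonneg_right hsq hBC.le
    exact mul_le_mul_of_nonneg_right (mul_le_mul_of_nonneg_right hk (inv_nonneg.2 (pow_nonneg (B9CubeGeometryInputs.geoCK_len_pos i c a).le 4)))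
      (Real.exp_nonneg _)
  have hScK : ∀ c : ↥(cubes (toKT i).D.toDomains), HasMajorant (g := toB6 (geoCK i c) (Rr i) (Hp i)) (fun p : SiteY i × ι => blkCubeY i c p.1)
      (conj b ((((((etaS i ^ 2 * etaS i ^ 2)⁻¹ : ℝ) : ℂ)) • (QpsCubeY i c (parSymY i) (locCfgY i c (kGeo i).eta (A c)) ∘ₗ
        XinvCubeY i c (parSymY i) (locCfgY i c (kGeo i).eta (A c)) ∘ₗ QpCubeY i c (parSymY i) (locCfgY i c (kGeo i).eta (A c)))).restrictScalars ℝ))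
      (fun a s => BS * ((geoCK i c).len a ^ 4)⁻¹ * Real.exp (-(m / 2 * (geoCK i c).dist a s))) :=
    fun c => hasMajorant_mono (g := toB6 (geoCK i c) (Rr i) (Hp i)) _ (hScC c) fun a s =>
      kernel_rate_mono (hdnnC c) (by linarith only [hmC, hm.le]) (mul_nonneg hBS (inv_nonneg.2 (pow_nonneg (B9CubeGeometryInputs.geoCK_len_pos i c a).le 4))) a s
  -- the cube `η²G′_□(Ṽ_□)` block
  have hBc : ∀ c : ↥(cubes (toKT i).D.toDomains), HasMajorant (g := toB6 (geoCK i c) (Rr i) (Hp i)) (fun p : SiteY i × ι => blkCubeY i c p.1)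
      (conj b ((((((etaS i ^ 2 : ℝ)) : ℂ)) • GpCubeY i c (parSymY i) (locCfgY i c (kGeo i).eta (A c))).restrictScalars ℝ))
      (fun a s => Bf * (geoCK i c).len a ^ 2 * Real.exp (-(δB * (geoCK i c).dist a s))) := by
    intro c
    have h := (HBc c).2.1
    have e2 : ((((kGeo i).eta ^ 2 : ℝ)) : ℂ) = ((((etaS i ^ 2 : ℝ)) : ℂ)) := by rw [hetaS]
    rw [GpVK_eq_conj_smul, e2] at h
    exact h
  -- E3f's adjoint cube letter weakened to the rate `m∕2`, and transferred to the member at the rate `3m∕8`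
  have hTcK : ∀ c : ↥(cubes (toKT i).D.toDomains), HasMajorant (g := toB6 (geoCK i c) (Rr i) (Hp i)) (fun p : SiteY i × ι => blkCubeY i c p.1)
      (conj b ((GpCubeY i c (parSymY i) (locCfgY i c (kGeo i).eta (A c)) *
        (deltaPrimeACubeY i c (parSymY i) (locCfgY i c (kGeo i).eta (A c)) * cutMulY (𝔸 := 𝔸) (chiY i c) -
          cutMulY (𝔸 := 𝔸) (chiY i c) * deltaPrimeACubeY i c (parSymY i) (locCfgY i c (kGeo i).eta (A c)))).restrictScalars ℝ))
      (fun a s => θS * Real.exp (-(m / 2 * (geoCK i c).dist a s))) :=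
    fun c => hasMajorant_mono (g := toB6 (geoCK i c) (Rr i) (Hp i)) _ (hTc c) fun a s =>
      kernel_rate_mono (hdnnC c) (by linarith only [hmS, hm.le]) hθS a s
  have hGK : ∀ c : ↥(cubes (toKT i).D.toDomains), HasMajorant (g := toB6 (geo9K i) (Rr i) (Hp i)) (fun p : SiteY i × ι => ιB (blkOf i.D.toDomains p.1))
      (conj b ((GpCubeY i c (parSymY i) (gaugeY i (u c)⁻¹ (locCfgY i c (kGeo i).eta (A c))) *
        (deltaPrimeACubeY i c (parSymY i) (gaugeY i (u c)⁻¹ (locCfgY i c (kGeo i).eta (A c))) * cutMulY (𝔸 := 𝔸) (chiY i c) -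
          cutMulY (𝔸 := 𝔸) (chiY i c) * deltaPrimeACubeY i c (parSymY i) (gaugeY i (u c)⁻¹ (locCfgY i c (kGeo i).eta (A c))))).restrictScalars ℝ))
      (fun a y'' => ((M₂ * ∑ j, ‖b j‖) ^ 2 * (θS * B6.c1 dBS δS (1 / 2))) * Real.exp (-(3 / 8 * m * (geo9K i).dist a y''))) :=
    fun c => hasMajorant_conj_commStepAdj_member_rate i c b hM₂ hrepr (parSymY_isGaugeLawS i) (u c) (hu c) (locCfgY i c (kGeo i).eta (A c)) ιB hι dBS
      hθS hδS.le (by norm_num) (by linarith only [hmS, hm.le] : 3 / 8 * m ≤ (1 - 1 / 2) * δS) (h261Sc c) (hTc c)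
  -- ─── the located tails (FILES 8a∕8b∕8c), each restated with the named constants ───
  have hRop : ∀ (c : ↥(cubes (toKT i).D.toDomains)) (ν : Fin (d + 1)), HasMajorant (g := toB6 (geo9K i) (Rr i) (Hp i))
      (fun p : SiteY i × ι => ιB (blkOf i.D.toDomains p.1))
      (conj b (((((etaS i ^ 2 : ℝ) : ℂ)) • GpCubeY i c (parSymY i) (gaugeY i (u c)⁻¹ (locCfgY i c (kGeo i).eta (A c)))).restrictScalars ℝ) *
        mulOp (fun p : SiteY i × ι => bumpY i (ctrR i c) (3 * (SC i c : ℝ)) p.1) * conj b (diffLetter (shiftY i) (UboxY i (cfg U₁)) (((etaS i : ℝ) : ℂ))⁻¹ (Sum.inr ν)))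
      (fun a a' => κR * (geo9K i).len a * Real.exp (-(1 / 8 * m * (geo9K i).dist a a'))) := by
    intro c ν
    have h := hasMajorant_rightEntry_at i c b cfg hE hBG ιB hι hM₂ hrepr hη ν (u c) (kGeo i).eta (A c) (hQ c) (hgA c) hU (hV c) e22
      hm.le (by linarith only [hmG] : 1 * m ≤ δG) (by norm_num : (0 : ℝ) ≤ 1 / 32) hL0.le hST1t hθK (by norm_num : (0 : ℝ) ≤ 1 / 8)
      (by norm_num : (1 : ℝ) / 8 ≤ 1 - 1 / 32) (by norm_num : (1 : ℝ) / 8 + (1 / 32 + 1 / 32) ≤ 3 / 8) h261_22t (hGK c)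
    refine hasMajorant_mono (g := toB6 (geo9K i) (Rr i) (Hp i)) _ h fun a a' => ?_
    rw [hκRdef]
  have hLw : ∀ (c : ↥(cubes (toKT i).D.toDomains)) (μ : Fin (d + 1)), HasMajorant (g := toB6 (geo9K i) (Rr i) (Hp i))
      (fun p : SiteY i × ι => ιB (blkOf i.D.toDomains p.1))
      (conj b (diffLetter (shiftY i) (UboxY i (cfg U₁)) (((etaS i : ℝ) : ℂ))⁻¹ (Sum.inl μ)) * mulOp (fun p : SiteY i × ι => bumpY i (ctrR i c) (3 * (SC i c : ℝ)) p.1) *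
        conj b (((((etaS i ^ 2 : ℝ) : ℂ)) • GpCubeY i c (parSymY i) (gaugeY i (u c)⁻¹ (locCfgY i c (kGeo i).eta (A c)))).restrictScalars ℝ))
      (fun a a' : (geo9K i).Site => (if a ∈ (Finset.univ.filter fun a : (geo9K i).Site => ∃ z : SiteY i, ιB (blkOf i.D.toDomains z) = a ∧ NearC i c (21 * SC i c / 8 + 1) z.1)
        then (1 : ℝ) else 0) * (κL * (geo9K i).len a * Real.exp (-(1 / 8 * m * (geo9K i).dist a a')))) := by
    intro c μ
    have h := hasMajorant_leftEntry_at i c b cfg hE hBG ιB hι hM₂ hrepr μ (u c) (hu c) (kGeo i).eta (A c) (hQ c) (hgA c) hU (hV c) dBS hθS hδS.le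
      (by norm_num : (1 : ℝ) / 2 ≤ 1) (h261Sc c) (hR c) e22 hm.le (by norm_num : (0 : ℝ) ≤ 1 / 8) (by positivity : (0 : ℝ) ≤ 1 / 32 * m)
      (by positivity : (0 : ℝ) ≤ 1 / 32 * m) (by linarith only [hmG, hm.le] : 1 / 8 * m + (1 / 32 + 1 / 32) * m ≤ δG)
      (by linarith only [hmS, hm.le] : 1 / 8 * m ≤ (1 - 1 / 2) * δS) h261_22t
    refine hasMajorant_mono (g := toB6 (geo9K i) (Rr i) (Hp i)) _ h fun a a' => ?_
    have hSC : (0 : ℝ) < (SC i c : ℝ) := by exact_mod_cast lt_of_lt_of_le one_pos (one_le_SC i c)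
    have hcancel : |(etaS i)⁻¹| * (D1 thetaProf / (3 * (SC i c : ℝ))) * ((SC i c : ℝ) * (kGeo i).eta) = D1 thetaProf / 3 := by
      rw [abs_of_pos (inv_pos.2 hη0), ← hetaS]; field_simp
    have hκ : (M₂ * (∑ j, ‖b j‖) * BG + |(etaS i)⁻¹| * (D1 thetaProf / (3 * (SC i c : ℝ))) * ((SC i c : ℝ) * (kGeo i).eta) * (M₂ * (∑ j, ‖b j‖) * BG)) *
        (1 + (M₂ * ∑ j, ‖b j‖) ^ 2 * (θS * B6.c1 dBS δS (1 / 2)) * B6.c1 e22 m (1 / 32)) = κL := by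
      rw [hcancel, hκLdef]; ring
    rw [← hκ]
  have hTail0 : ∀ (c : ↥(cubes (toKT i).D.toDomains)) (ν : Fin (d + 1)), HasMajorant (g := toB6 (geo9K i) (Rr i) (Hp i))
      (fun p : SiteY i × ι => ιB (blkOf i.D.toDomains p.1))
      (conj b ((((((etaS i ^ 2 * etaS i ^ 2)⁻¹ : ℝ) : ℂ)) • (QpsCubeY i c (parSymY i) (gaugeY i (u c)⁻¹ (locCfgY i c (kGeo i).eta (A c))) ∘ₗ
          XinvCubeY i c (parSymY i) (gaugeY i (u c)⁻¹ (locCfgY i c (kGeo i).eta (A c))) ∘ₗ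
            QpCubeY i c (parSymY i) (gaugeY i (u c)⁻¹ (locCfgY i c (kGeo i).eta (A c))))).restrictScalars ℝ) *
        mulOp (fun p : SiteY i × ι => if NearC i c (3 * SC i c) p.1.1 then (1 : ℝ) else 0) *
        (conj b (((((etaS i ^ 2 : ℝ) : ℂ)) • GpCubeY i c (parSymY i) (gaugeY i (u c)⁻¹ (locCfgY i c (kGeo i).eta (A c)))).restrictScalars ℝ) *
          mulOp (fun p : SiteY i × ι => bumpY i (ctrR i c) (3 * (SC i c : ℝ)) p.1) * conj b (diffLetter (shiftY i) (UboxY i (cfg U₁)) (((etaS i : ℝ) : ℂ))⁻¹ (Sum.inr ν))))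
      (fun a a' => κT0 * ((geo9K i).len a ^ 3)⁻¹ * Real.exp (-(1 / 8 * m * (geo9K i).dist a a'))) := by
    intro c ν
    have h := hasMajorant_tail0_at i c b hM₂ hrepr (u c) (hu c) (locCfgY i c (kGeo i).eta (A c)) ιB hι ((((etaS i ^ 2 * etaS i ^ 2)⁻¹ : ℝ) : ℂ))
      hBS (by positivity : (0 : ℝ) ≤ ((ℓ : ℝ) + 1) ^ 4) (by linarith only [hm.le] : (0 : ℝ) ≤ m / 2 - 1 / 2 * (m / 2)) (hSTcK c) (hScK c) e22
      (by positivity : (0 : ℝ) ≤ ((ℓ : ℝ) + 1) ^ 4) hκR hL0.le (by positivity : (0 : ℝ) ≤ 1 / 8 * m)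
      (by linarith only [hm.le] : 1 / 8 * m + (1 / 32 + 1 / 32) * m ≤ m / 2 - 1 / 2 * (m / 2) - 1 / 32 * m) hST4t hST1t h261_22t (hRop c ν)
    refine hasMajorant_mono (g := toB6 (geo9K i) (Rr i) (Hp i)) _ h fun a a' => ?_
    rw [hκT0def]
  have hTail1 : ∀ (c : ↥(cubes (toKT i).D.toDomains)) (ν : Fin (d + 1)), HasMajorant (g := toB6 (geo9K i) (Rr i) (Hp i))
      (fun p : SiteY i × ι => ιB (blkOf i.D.toDomains p.1))
      (conj b (((((etaS i ^ 2 : ℝ) : ℂ)) • GpCubeY i c (parSymY i) (gaugeY i (u c)⁻¹ (locCfgY i c (kGeo i).eta (A c)))).restrictScalars ℝ) *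
        (conj b ((((((etaS i ^ 2 * etaS i ^ 2)⁻¹ : ℝ) : ℂ)) • (QpsCubeY i c (parSymY i) (gaugeY i (u c)⁻¹ (locCfgY i c (kGeo i).eta (A c))) ∘ₗ
            XinvCubeY i c (parSymY i) (gaugeY i (u c)⁻¹ (locCfgY i c (kGeo i).eta (A c))) ∘ₗ
              QpCubeY i c (parSymY i) (gaugeY i (u c)⁻¹ (locCfgY i c (kGeo i).eta (A c))))).restrictScalars ℝ) *
          mulOp (fun p : SiteY i × ι => if NearC i c (3 * SC i c) p.1.1 then (1 : ℝ) else 0) *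
          (conj b (((((etaS i ^ 2 : ℝ) : ℂ)) • GpCubeY i c (parSymY i) (gaugeY i (u c)⁻¹ (locCfgY i c (kGeo i).eta (A c)))).restrictScalars ℝ) *
            mulOp (fun p : SiteY i × ι => bumpY i (ctrR i c) (3 * (SC i c : ℝ)) p.1) * conj b (diffLetter (shiftY i) (UboxY i (cfg U₁)) (((etaS i : ℝ) : ℂ))⁻¹ (Sum.inr ν)))))
      (fun a a' => κT1 * ((geo9K i).len a)⁻¹ * Real.exp (-(1 / 8 * m * (geo9K i).dist a a'))) := by
    intro c ν
    have h := hasMajorant_tail1_at i c b hM₂ hrepr (u c) (hu c) (locCfgY i c (kGeo i).eta (A c)) ιB hι ((((etaS i ^ 2 : ℝ)) : ℂ)) dBBc hBf hδB.le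
      (by norm_num : (1 : ℝ) / 2 ≤ 1) (h261Bc' c) (hBc c) e22 hκT0 (by positivity : (0 : ℝ) ≤ ((ℓ : ℝ) + 1) ^ 3) (by positivity : (0 : ℝ) ≤ 1 / 8 * m)
      (by linarith only [hmB, hm.le] : 1 / 8 * m + (1 / 32 + 1 / 32) * m ≤ (1 - 1 / 2) * δB) hST3t h261_22t (hTail0 c ν)
    refine hasMajorant_mono (g := toB6 (geo9K i) (Rr i) (Hp i)) _ h fun a a' => ?_
    rw [hκT1def]
  have hTail2 : ∀ (c : ↥(cubes (toKT i).D.toDomains)) (ν : Fin (d + 1)), HasMajorant (g := toB6 (geo9K i) (Rr i) (Hp i))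
      (fun p : SiteY i × ι => ιB (blkOf i.D.toDomains p.1))
      (conj b (((((etaS i ^ 2 : ℝ) : ℂ)) • GpCubeY i c (parSymY i) (gaugeY i (u c)⁻¹ (locCfgY i c (kGeo i).eta (A c)))).restrictScalars ℝ) *
        conj b (((((etaS i ^ 2 : ℝ) : ℂ)) • GpCubeY i c (parSymY i) (gaugeY i (u c)⁻¹ (locCfgY i c (kGeo i).eta (A c)))).restrictScalars ℝ) *
        (conj b ((((((etaS i ^ 2 * etaS i ^ 2)⁻¹ : ℝ) : ℂ)) • (QpsCubeY i c (parSymY i) (gaugeY i (u c)⁻¹ (locCfgY i c (kGeo i).eta (A c))) ∘ₗ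
            XinvCubeY i c (parSymY i) (gaugeY i (u c)⁻¹ (locCfgY i c (kGeo i).eta (A c))) ∘ₗ
              QpCubeY i c (parSymY i) (gaugeY i (u c)⁻¹ (locCfgY i c (kGeo i).eta (A c))))).restrictScalars ℝ) *
          mulOp (fun p : SiteY i × ι => if NearC i c (3 * SC i c) p.1.1 then (1 : ℝ) else 0) *
          (conj b (((((etaS i ^ 2 : ℝ) : ℂ)) • GpCubeY i c (parSymY i) (gaugeY i (u c)⁻¹ (locCfgY i c (kGeo i).eta (A c)))).restrictScalars ℝ) *
            mulOp (fun p : SiteY i × ι => bumpY i (ctrR i c) (3 * (SC i c : ℝ)) p.1) * conj b (diffLetter (shiftY i) (UboxY i (cfg U₁)) (((etaS i : ℝ) : ℂ))⁻¹ (Sum.inr ν)))))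
      (fun a a' => κT2 * (geo9K i).len a * Real.exp (-(1 / 8 * m * (geo9K i).dist a a'))) := by
    intro c ν
    have h := hasMajorant_tail2_at i c b hM₂ hrepr (u c) (hu c) (locCfgY i c (kGeo i).eta (A c)) ιB hι ((((etaS i ^ 2 : ℝ)) : ℂ)) dBBc hBf hδB.le
      (by norm_num : (1 : ℝ) / 2 ≤ 1) (h261Bc' c) (hBc c) e22 hκT0 (by positivity : (0 : ℝ) ≤ ((ℓ : ℝ) + 1) ^ 2) (by positivity : (0 : ℝ) ≤ ((ℓ : ℝ) + 1) ^ 3)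
      (by positivity : (0 : ℝ) ≤ 1 / 8 * m) (by positivity : (0 : ℝ) ≤ 1 / 4 * m) (by positivity : (0 : ℝ) ≤ (1 / 32 + 1 / 32) * m)
      (by linarith only [hm.le] : 1 / 8 * m + (1 / 32 + 1 / 32) * m ≤ 1 / 4 * m)
      (by linarith only [hmB, hm.le] : 1 / 4 * m + (1 / 32 + 1 / 32) * m ≤ (1 - 1 / 2) * δB) hST2t hST3t h261_22t (hTail0 c ν)
    refine hasMajorant_mono (g := toB6 (geo9K i) (Rr i) (Hp i)) _ h fun a a' => ?_
    rw [hκT2def]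
  have hSbL : ∀ c : ↥(cubes (toKT i).D.toDomains), HasMajorant (g := toB6 (geo9K i) (Rr i) (Hp i)) (fun p : SiteY i × ι => ιB (blkOf i.D.toDomains p.1))
      (mulOp (fun p : SiteY i × ι => if NearC i c (3 * SC i c) p.1.1 then (1 : ℝ) else 0) *
        conj b ((((((etaS i ^ 2 * etaS i ^ 2)⁻¹ : ℝ) : ℂ)) • (QpsCubeY i c (parSymY i) (gaugeY i (u c)⁻¹ (locCfgY i c (kGeo i).eta (A c))) ∘ₗ
          XinvCubeY i c (parSymY i) (gaugeY i (u c)⁻¹ (locCfgY i c (kGeo i).eta (A c))) ∘ₗ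
            QpCubeY i c (parSymY i) (gaugeY i (u c)⁻¹ (locCfgY i c (kGeo i).eta (A c))))).restrictScalars ℝ))
      (fun a a' => κSb * ((geo9K i).len a ^ 4)⁻¹ * Real.exp (-((1 - 1 / 2) * δC * (geo9K i).dist a a'))) := by
    intro c
    have h := hasMajorant_sbL_at (Rr' := Rr i) (Hp := Hp i) i c b hM₂ hrepr (u c) (hu c) (locCfgY i c (kGeo i).eta (A c)) ιB hι
      ((((etaS i ^ 2 * etaS i ^ 2)⁻¹ : ℝ) : ℂ)) dBCc hBS hδC.le (by norm_num : (1 : ℝ) / 2 ≤ 1) (h261Cc' c) (hScC c)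
    refine hasMajorant_mono (g := toB6 (geo9K i) (Rr i) (Hp i)) _ h fun a a' => ?_
    rw [hκSbdef]
  have hTK : ∀ c : ↥(cubes (toKT i).D.toDomains), HasMajorant (g := toB6 (geo9K i) (Rr i) (Hp i)) (fun p : SiteY i × ι => ιB (blkOf i.D.toDomains p.1))
      (conj b ((((((etaS i ^ 2 * etaS i ^ 2)⁻¹ : ℝ) : ℂ)) • (QpsCubeY i c (parSymY i) (gaugeY i (u c)⁻¹ (locCfgY i c (kGeo i).eta (A c))) ∘ₗ
          XinvCubeY i c (parSymY i) (gaugeY i (u c)⁻¹ (locCfgY i c (kGeo i).eta (A c))) ∘ₗ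
            QpCubeY i c (parSymY i) (gaugeY i (u c)⁻¹ (locCfgY i c (kGeo i).eta (A c))))).restrictScalars ℝ) *
        conj b (((GpCubeY i c (parSymY i) (gaugeY i (u c)⁻¹ (locCfgY i c (kGeo i).eta (A c))) *
          (deltaPrimeACubeY i c (parSymY i) (gaugeY i (u c)⁻¹ (locCfgY i c (kGeo i).eta (A c))) * cutMulY (𝔸 := 𝔸) (chiY i c) -
            cutMulY (𝔸 := 𝔸) (chiY i c) * deltaPrimeACubeY i c (parSymY i) (gaugeY i (u c)⁻¹ (locCfgY i c (kGeo i).eta (A c))))).restrictScalars ℝ :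
          Module.End ℝ (SiteY i → 𝔸))))
      (fun a a' => κK * ((geo9K i).len a ^ 4)⁻¹ * Real.exp (-((m / 2 - 1 / 2 * (m / 2) - 1 / 32 * m) * (geo9K i).dist a a'))) := by
    intro c
    have h := hasMajorant_tk_at (Rr' := Rr i) (Hp := Hp i) i c b hM₂ hrepr (u c) (hu c) (locCfgY i c (kGeo i).eta (A c)) ιB hι
      ((((etaS i ^ 2 * etaS i ^ 2)⁻¹ : ℝ) : ℂ)) dBCc hBS hθS (by positivity : (0 : ℝ) ≤ m / 2)
      (by linarith only [hmC] : m / 2 + (0 + 1 / 2) * δC ≤ δC) (h261Cc' c) (by positivity : (0 : ℝ) ≤ ((ℓ : ℝ) + 1) ^ 4)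
      (by linarith only [hm.le] : (0 : ℝ) ≤ m / 2 - 1 / 2 * (m / 2)) (hSTcK c) (hScC c) (hTcK c) hST4t
    refine hasMajorant_mono (g := toB6 (geo9K i) (Rr i) (Hp i)) _ h fun a a' => ?_
    rw [hκKdef]
  have hGw : ∀ (c : ↥(cubes (toKT i).D.toDomains)) (ν : Fin (d + 1)), HasMajorant (g := toB6 (geo9K i) (Rr i) (Hp i))
      (fun p : SiteY i × ι => ιB (blkOf i.D.toDomains p.1))
      (conj b ((((((etaS i ^ 2 * etaS i ^ 2)⁻¹ : ℝ) : ℂ)) • (QpsCubeY i c (parSymY i) (gaugeY i (u c)⁻¹ (locCfgY i c (kGeo i).eta (A c))) ∘ₗ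
          XinvCubeY i c (parSymY i) (gaugeY i (u c)⁻¹ (locCfgY i c (kGeo i).eta (A c))) ∘ₗ
            QpCubeY i c (parSymY i) (gaugeY i (u c)⁻¹ (locCfgY i c (kGeo i).eta (A c))))).restrictScalars ℝ) *
        (conj b (((((etaS i ^ 2 : ℝ) : ℂ)) • GpCubeY i c (parSymY i) (gaugeY i (u c)⁻¹ (locCfgY i c (kGeo i).eta (A c)))).restrictScalars ℝ) *
          mulOp (fun p : SiteY i × ι => bumpY i (ctrR i c) (3 * (SC i c : ℝ)) p.1) * conj b (diffLetter (shiftY i) (UboxY i (cfg U₁)) (((etaS i : ℝ) : ℂ))⁻¹ (Sum.inr ν))))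
      (fun a a' => κG * ((geo9K i).len a ^ 3)⁻¹ * Real.exp (-(1 / 16 * m * (geo9K i).dist a a'))) := by
    intro c ν
    have h := hasMajorant_gw_at i c b cfg hE hBG ιB hι hM₂ hrepr hη ν (u c) (hu c) (kGeo i).eta (A c) (hQ c) (hgA c) hU (hV c)
      ((((etaS i ^ 2 * etaS i ^ 2)⁻¹ : ℝ) : ℂ)) hBS (by positivity : (0 : ℝ) ≤ ((ℓ : ℝ) + 1) ^ 4)
      (by linarith only [hm.le] : (0 : ℝ) ≤ m / 2 - 1 / 2 * (m / 2)) (hSTcK c) (hScK c) e22 hm.le (by linarith only [hmG] : 1 * m ≤ δG)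
      (by norm_num : (0 : ℝ) ≤ 1 / 32) hL0.le hST1t (by norm_num : (0 : ℝ) ≤ 1 / 16) (by norm_num : (1 : ℝ) / 16 ≤ 1 - 1 / 32) h261_22t
      (by positivity : (0 : ℝ) ≤ ((ℓ : ℝ) + 1) ^ 4) hST4t hκK
      (by linarith only [hm.le] : 1 / 16 * m + (1 / 32 + 1 / 32) * m ≤ m / 2 - 1 / 2 * (m / 2) - 1 / 32 * m) (hTK c)
    refine hasMajorant_mono (g := toB6 (geo9K i) (Rr i) (Hp i)) _ h fun a a' => ?_
    rw [hκGdef]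
  have hPb := fun c : ↥(cubes (toKT i).D.toDomains) =>
    hasMajorant_projCube_member (Rr' := Rr i) (Hp := Hp i) i c b (Rr i) (Hp i) hM₂ hrepr (gaugeY i (u c)⁻¹ (locCfgY i c (kGeo i).eta (A c))) (hparV c) ιB
  -- ─── the common collar factor ───
  obtain ⟨E, hEdef⟩ : ∃ x : ℝ, x = Real.exp (-(3 / 128 * m * (3 / 8 * (i.Mh : ℝ) - 3))) := ⟨_, rfl⟩
  have hE0 : 0 ≤ E := by rw [hEdef]; exact Real.exp_nonneg _
  have hE1 : E ≤ 1 := by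
    rw [hEdef]; refine Real.exp_le_one_iff.mpr ?_
    have h38 : 0 ≤ 3 / 8 * (i.Mh : ℝ) - 3 := by linarith only [hMh8]
    have := mul_nonneg (by positivity : (0 : ℝ) ≤ 3 / 128 * m) h38
    linarith only [this]
  have hEG1 : Real.exp (-(1 / 8 * δG * (3 / 8 * (i.Mh : ℝ) - 1))) ≤ E := by
    rw [hEdef]; exact exp_collar_le (by positivity) (by linarith only [hmG, hm.le]) (by norm_num) hMh8
  have hEG2 : Real.exp (-(1 / 8 * δG * (3 / 8 * (i.Mh : ℝ) - 2))) ≤ E := by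
    rw [hEdef]; exact exp_collar_le (by positivity) (by linarith only [hmG, hm.le]) (by norm_num) hMh8
  have hE31 : Real.exp (-(1 / 8 * m * (3 / 8 * (i.Mh : ℝ) - 1))) ≤ E := by
    rw [hEdef]; exact exp_collar_le (by positivity) (by linarith only [hm.le]) (by norm_num) hMh8
  have hE33 : Real.exp (-(1 / 8 * m * (3 / 8 * (i.Mh : ℝ) - 3))) ≤ E := by
    rw [hEdef]; exact exp_collar_le (by positivity) (by linarith only [hm.le]) (by norm_num) hMh8
  have hEw1 : Real.exp (-((3 / 128 * m) * (3 / 8 * (i.Mh : ℝ) - 1))) ≤ E := by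
    rw [hEdef]; exact exp_collar_le (by positivity) le_rfl (by norm_num) hMh8
  have hEw2 : Real.exp (-((3 / 128 * m) * (3 / 8 * (i.Mh : ℝ) - 2))) ≤ E := by
    rw [hEdef]; exact exp_collar_le (by positivity) le_rfl (by norm_num) hMh8
  -- the three budgets with the collar factors bounded by `E`
  obtain ⟨εR, hεRdef⟩ : ∃ x : ℝ, x = ((M₂ * ∑ j, ‖b j‖) * BG * (1 + ((ℓ : ℝ) + 1) * (D1 thetaProf / 3))) * (E + ((M₂ * ∑ j, ‖b j‖) ^ 2 * (θS * B6.c1 dBS δS (1 / 2))) * ((ℓ : ℝ) + 1) * B6.c1 e12 m (1 - 1 / 8 - 1 / 8 - 1 / 8) * E) := ⟨_, rfl⟩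
  obtain ⟨εT, hεTdef⟩ : ∃ x : ℝ, x = ((M₂ * ∑ j, ‖b j‖) * BG * (1 + D1 thetaProf / 3)) * (E + ((M₂ * ∑ j, ‖b j‖) ^ 2 * (θS * B6.c1 dBS δS (1 / 2))) * B6.c1 e12 δG (m / (4 * δG) - m / (8 * δG)) * E) + εR := ⟨_, rfl⟩
  obtain ⟨ε₃, hε₃def⟩ : ∃ x : ℝ, x = ((d : ℝ) + 1) * (κL * ((M₂ * ∑ j, ‖b j‖) ^ 2 * B₁) * (M₂ * ∑ j, ‖b j‖) ^ 2 * κT2 * (((ℓ : ℝ) + 1) ^ 4 * ((ℓ : ℝ) + 1)) * B6.c1 e21 m (1 / 256) ^ 2 * E + κL * ((M₂ * ∑ j, ‖b j‖) ^ 2 * B₁) * (M₂ * (∑ j, ‖b j‖) * BG) ^ 2 * (M₂ * ∑ j, ‖b j‖) ^ 2 * κT0 * (((ℓ : ℝ) + 1) ^ 4 * (((ℓ : ℝ) + 1) ^ 2) ^ 2 * ((ℓ : ℝ) + 1) ^ 3) * B6.c1 e21 m (1 / 256) ^ 4 * E + κL * ((M₂ * ∑ j, ‖b j‖) ^ 2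 * B₁) * (M₂ * (∑ j, ‖b j‖) * BG) ^ 2 * ((M₂ * ∑ j, ‖b j‖) ^ 2 * (θS * B6.c1 dBS δS (1 / 2))) * κT0 * (((ℓ : ℝ) + 1) ^ 4 * (((ℓ : ℝ) + 1) ^ 2) ^ 2 * ((ℓ : ℝ) + 1) ^ 3) * B6.c1 e21 m (1 / 256) ^ 5 * E + κL * ((M₂ * ∑ j, ‖b j‖) ^ 2 * B₁) * (M₂ * (∑ j, ‖b j‖) * BG) * ((M₂ * ∑ j, ‖b j‖) ^ 2 * (θS * B6.c1 dBS δS (1 / 2))) * κT1 * (((ℓ : ℝ) + 1) ^ 4 * ((ℓ : ℝ) + 1) ^ 2 * ((ℓ : ℝ) + 1)) * B6.c1 e21 m (1 / 256) ^ 4 * E + κL * ((M₂ * ∑ j, ‖b j‖) ^ 2 * B₁) * κR * (((ℓ : ℝ) + 1) ^ 4 * ((ℓ : ℝ) + 1)) * B6.c1 e21 m (1 / 256) ^ 2 * E + κL * κSb * κR * (((ℓ : ℝ) + 1) ^ 4 * ((ℓ : ℝ) + 1)) * B6.c1 e21 m (1 / 256) ^ 2 * E + κL * E * (((M₂ * ∑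 j, ‖b j‖) ^ 2 * B₁) * κR * ((ℓ : ℝ) + 1) * B6.c1 e21 m (1 / 256)) * ((ℓ : ℝ) + 1) ^ 3 * B6.c1 e21 m (1 / 256) + κL * E * κG * ((ℓ : ℝ) + 1) ^ 3 * B6.c1 e21 m (1 / 256)) := ⟨_, rfl⟩
  have hεR0 : 0 ≤ εR := by rw [hεRdef]; positivity
  have hεT0 : 0 ≤ εT := by rw [hεTdef]; positivity
  have hεDT : ((M₂ * ∑ j, ‖b j‖) * BG * (1 + D1 thetaProf / 3)) * (Real.exp (-(1 / 8 * δG * (3 / 8 * (i.Mh : ℝ) - 1))) + ((M₂ * ∑ j, ‖b j‖) ^ 2 * (θS * B6.c1 dBS δS (1 / 2))) * B6.c1 e12 δG (m / (4 * δG) - m / (8 * δG)) * Real.exp (-(1 / 8 * δG * (3 / 8 * (i.Mh : ℝ) - 2)))) ≤ εT := by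
    have h1 : ((M₂ * ∑ j, ‖b j‖) * BG * (1 + D1 thetaProf / 3)) * (Real.exp (-(1 / 8 * δG * (3 / 8 * (i.Mh : ℝ) - 1))) + ((M₂ * ∑ j, ‖b j‖) ^ 2 * (θS * B6.c1 dBS δS (1 / 2))) * B6.c1 e12 δG (m / (4 * δG) - m / (8 * δG)) * Real.exp (-(1 / 8 * δG * (3 / 8 * (i.Mh : ℝ) - 2)))) ≤ ((M₂ * ∑ j, ‖b j‖) * BG * (1 + D1 thetaProf / 3)) * (E + ((M₂ * ∑ j, ‖b j‖) ^ 2 * (θS * B6.c1 dBS δS (1 / 2))) * B6.c1 e12 δG (m / (4 * δG) - m / (8 * δG)) * E) := by gcongr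
    rw [hεTdef]; linarith only [h1, hεR0]
  have hεR3 : ((M₂ * ∑ j, ‖b j‖) * BG * (1 + ((ℓ : ℝ) + 1) * (D1 thetaProf / 3))) * (Real.exp (-(1 / 8 * m * (3 / 8 * (i.Mh : ℝ) - 1))) + ((M₂ * ∑ j, ‖b j‖) ^ 2 * (θS * B6.c1 dBS δS (1 / 2))) * ((ℓ : ℝ) + 1) * B6.c1 e12 m (1 - 1 / 8 - 1 / 8 - 1 / 8) * Real.exp (-(1 / 8 * m * (3 / 8 * (i.Mh : ℝ) - 3)))) ≤ εR := by
    rw [hεRdef]; gcongr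
  have hεRT : εR ≤ εT := by
    rw [hεTdef]
    have h0 : 0 ≤ ((M₂ * ∑ j, ‖b j‖) * BG * (1 + D1 thetaProf / 3)) * (E + ((M₂ * ∑ j, ‖b j‖) ^ 2 * (θS * B6.c1 dBS δS (1 / 2))) * B6.c1 e12 δG (m / (4 * δG) - m / (8 * δG)) * E) := by positivity
    linarith only [h0]
  have hε₃w : ((d : ℝ) + 1) * (κL * ((M₂ * ∑ j, ‖b j‖) ^ 2 * B₁) * (M₂ * ∑ j, ‖b j‖) ^ 2 * κT2 * (((ℓ : ℝ) + 1) ^ 4 * ((ℓ : ℝ) + 1)) * B6.c1 e21 m (1 / 256) ^ 2 * Real.exp (-((3 / 128 * m) * (3 / 8 * (i.Mh : ℝ) - 1))) + κL * ((M₂ * ∑ j, ‖b j‖) ^ 2 * B₁) * (M₂ * (∑ j, ‖b j‖) * BG) ^ 2 * (M₂ * ∑ j, ‖b j‖) ^ 2 * κT0 * (((ℓ : ℝ) + 1) ^ 4 * (((ℓ : ℝ) + 1) ^ 2) ^ 2 * ((ℓ : ℝ) + 1) ^ 3) * B6.c1 e21 m (1 / 256) ^ 4 * Real.exp (-((3 /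 128 * m) * (3 / 8 * (i.Mh : ℝ) - 1))) + κL * ((M₂ * ∑ j, ‖b j‖) ^ 2 * B₁) * (M₂ * (∑ j, ‖b j‖) * BG) ^ 2 * ((M₂ * ∑ j, ‖b j‖) ^ 2 * (θS * B6.c1 dBS δS (1 / 2))) * κT0 * (((ℓ : ℝ) + 1) ^ 4 * (((ℓ : ℝ) + 1) ^ 2) ^ 2 * ((ℓ : ℝ) + 1) ^ 3) * B6.c1 e21 m (1 / 256) ^ 5 * Real.exp (-((3 / 128 * m) * (3 / 8 * (i.Mh : ℝ) - 2))) + κL * ((M₂ * ∑ j, ‖b j‖) ^ 2 * B₁) * (M₂ * (∑ j, ‖b j‖) * BG) * ((M₂ * ∑ j, ‖b j‖) ^ 2 * (θS * B6.c1 dBS δS (1 / 2))) * κT1 * (((ℓ : ℝ) + 1) ^ 4 * ((ℓ : ℝ) + 1) ^ 2 * ((ℓ : ℝ) + 1)) * B6.c1 e21 m (1 / 256) ^ 4 * Real.exp (-((3 / 128 * m) * (3 / 8 * (i.Mh : ℝ) - 2))) + κL * ((M₂ * ∑ j, ‖b j‖) ^ 2 * B₁) * κR * (((ℓ : ℝ)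 + 1) ^ 4 * ((ℓ : ℝ) + 1)) * B6.c1 e21 m (1 / 256) ^ 2 * Real.exp (-((3 / 128 * m) * (3 / 8 * (i.Mh : ℝ) - 1))) + κL * κSb * κR * (((ℓ : ℝ) + 1) ^ 4 * ((ℓ : ℝ) + 1)) * B6.c1 e21 m (1 / 256) ^ 2 * Real.exp (-((3 / 128 * m) * (3 / 8 * (i.Mh : ℝ) - 1))) + κL * Real.exp (-((3 / 128 * m) * (3 / 8 * (i.Mh : ℝ) - 1))) * (((M₂ * ∑ j, ‖b j‖) ^ 2 * B₁) * κR * ((ℓ : ℝ) + 1) * B6.c1 e21 m (1 / 256)) * ((ℓ : ℝ) + 1) ^ 3 * B6.c1 e21 m (1 / 256) + κL * Real.exp (-((3 / 128 * m) * (3 / 8 * (i.Mh : ℝ) - 1))) * κG * ((ℓ : ℝ) + 1) ^ 3 * B6.c1 e21 m (1 / 256)) ≤ ε₃ := by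
    rw [hε₃def]; gcongr
  -- ─── the record ───
  have hrec := hasMajorant_sum_famThreeT_at_locCfg_of_tails i b cfg par
    hE hBG hδG.le Oc hBO hδO hEO ιB hι hpar hM₂ hrepr hη hs hB₁ hCinv u hu A Q (kGeo i).eta hQ hgA hU hV (Rr i) (Hp i) dBS e12 hθS hδS.le
    (by norm_num : (1 : ℝ) / 2 ≤ 1) (by norm_num : (0 : ℝ) ≤ 1 / 8) (by positivity : (0 : ℝ) ≤ m / (8 * δG))
    (by
      have : m / (8 * δG) ≤ 1 / 8 := by rw [div_le_iff₀ (by positivity)]; linarith only [hmG]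
      linarith only [this] : 1 / 8 + m / (8 * δG) ≤ 1)
    (by
      have : m / (4 * δG) * δG = m / 4 := by field_simp
      rw [this]; linarith only [hmS, hm.le] : m / (4 * δG) * δG ≤ (1 - 1 / 2) * δS)
    h261Sc h261_12G hR hεDT
    (by
      have : m / (8 * δG) * δG = 1 / 8 * m := by field_simp
      rw [this] : 1 / 8 * m ≤ m / (8 * δG) * δG)
    dBS hθS hδS.le (by norm_num : (1 : ℝ) / 2 ≤ 1) h261Sc hTc e12 hm.le (by linarith only [hmG] : 1 * m ≤ δG) (by norm_num : (0 : ℝ) ≤ 1 / 8) hL0.le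
    hT13 hL0.le hTst (by norm_num : (0 : ℝ) ≤ 1 / 8) (by norm_num : (0 : ℝ) ≤ 1 / 8) (by norm_num : (1 : ℝ) / 4 + 1 / 8 ≤ 3 / 8)
    (by linarith only [hmS, hm.le] : 3 / 8 * m ≤ (1 - 1 / 2) * δS) (by norm_num : (1 : ℝ) / 8 + 1 / 8 + 1 / 8 ≤ 1) h261_12m (hεR3.trans hεRT)
    (le_of_eq (by ring) : 1 / 8 * m ≤ 1 / 8 * m) hX hXc e21 hκL hκPb hκT0 hκT1 hκT2 hκSb hκR hκG (by positivity : (0 : ℝ) ≤ ((ℓ : ℝ) + 1) ^ 4)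
    (by positivity : (0 : ℝ) ≤ ((ℓ : ℝ) + 1) ^ 2) (by positivity : (0 : ℝ) ≤ ((ℓ : ℝ) + 1) ^ 3) hL0.le hL0.le (by positivity : (0 : ℝ) ≤ 1 / 256 * m)
    (by positivity : (0 : ℝ) ≤ (1 / 256 + 1 / 256) * m) (by positivity : (0 : ℝ) ≤ 3 / 128 * m)
    (by linarith only [hm.le] : (0 : ℝ) ≤ 1 / 8 * m - 5 * ((1 / 256 + 1 / 256) * m) - 3 / 128 * m)
    (by linarith only [hmX, hm.le] : 1 / 8 * m - (1 / 256 + 1 / 256) * m ≤ δX)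
    (by linarith only [hmG, hm.le] : 1 / 8 * m - 2 * ((1 / 256 + 1 / 256) * m) ≤ δG)
    (by
      have : m / (4 * δG) * δG = m / 4 := by field_simp
      rw [this]; linarith only [hm.le] : 1 / 8 * m - 3 * ((1 / 256 + 1 / 256) * m) - 3 / 128 * m ≤ m / (4 * δG) * δG)
    (by linarith only [hm.le] : 1 / 8 * m - 4 * ((1 / 256 + 1 / 256) * m) - 3 / 128 * m ≤ 1 / 8 * m)
    (by linarith only [hm.le] : 1 / 8 * m - 4 * ((1 / 256 + 1 / 256) * m) - 3 / 128 * m ≤ 1 / 8 * m)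
    (by linarith only [hm.le] : 1 / 8 * m - 2 * ((1 / 256 + 1 / 256) * m) - 3 / 128 * m ≤ 1 / 8 * m)
    (by linarith only [hm.le, hmC] : 1 / 8 * m - (1 / 256 + 1 / 256) * m ≤ (1 - 1 / 2) * δC)
    (by linarith only [hm.le] : 1 / 8 * m - 2 * ((1 / 256 + 1 / 256) * m) - 3 / 128 * m ≤ 1 / 8 * m)
    (by linarith only [hm.le] : 1 / 8 * m - 5 * ((1 / 256 + 1 / 256) * m) - 3 / 128 * m ≤ 1 / 16 * m) hST4w hST2w hST3w hSTm1w hST1w h261_21 hLw hRop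
    hTail0 hTail1 hTail2 hSbL hGw hPb e11 (le_trans hL1 ((pow_one _).symm.le.trans (hLpow (by norm_num))) : (1 : ℝ) ≤ ((ℓ : ℝ) + 1) ^ 4)
    (by positivity : (0 : ℝ) ≤ 1 / 16 * m) (by norm_num : (0 : ℝ) ≤ 1 / 8) (by norm_num : (0 : ℝ) ≤ 1 / 8) (by positivity : (0 : ℝ) ≤ 1 / 8 * m)
    (by linarith only [hmG, hm.le] : 1 / 8 * m ≤ δG) (by linarith only [hmX, hm.le] : 1 / 8 * m ≤ δX) (le_rfl : 1 / 8 * m ≤ 1 / 8 * m)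
    (by linarith only [hm.le] : 1 / 16 * m + (2 * (1 / 8) + 1 / 8) * (1 / 8 * m) ≤ 1 / 8 * m) h261_11 hT1 hT2 hT4 hε₃w
    (by linarith only [hm.le] : 1 / 16 * m ≤ 1 / 8 * m - 5 * ((1 / 256 + 1 / 256) * m) - 3 / 128 * m) dBQ hKQ hδQ.le (by norm_num : (1 : ℝ) / 2 ≤ 1)
    h261Qc hPlQ e22 (by positivity : (0 : ℝ) ≤ r' / 4) (by positivity : (0 : ℝ) ≤ ((ℓ : ℝ) + 1) ^ 2) hρ'.le
    (by rw [← hr'def]; linarith only [hr'.le] : r' / 4 + r' / 4 ≤ 1 / 16 * m / δO)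
    (by
      have : r' / 4 * δO + r' / 4 * δO = m / 32 := by rw [hr'def]; field_simp; ring
      rw [this]; linarith only [hmQ, hm.le] : r' / 4 * δO + r' / 4 * δO ≤ (1 - 1 / 2) * δQ)
    (by linarith only [hρ'2] : 1 / 2 + ρ' ≤ 1) h261_22O hSTO
  -- ─── the kernel: collect `E` and the (3.49) collar `e^{−a_sep·δ_O·D_sep}`, both rewritten in `M_h` ───
  refine hasMajorant_mono (g := toB6 (geo9K i) (Rr i) (Hp i)) _ hrec fun a a' => ?_
  have hεT_eq : εT = εT1 * E := by rw [hεTdef, hεRdef, hεT1def]; ring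
  have hε₃_eq : ε₃ = ε31 * E := by rw [hε₃def, hε31def]; ring
  have hMhEq : ((toKT i).Mh : ℝ) = (i.Mh : ℝ) := rfl
  have hDsep : Real.exp (-(r' / 4 * δO * DsepT i)) = Real.exp (-(m / 64 / (2 * ((ℓ : ℝ) + 1)) * ((toKT i).Mh : ℝ))) := by
    rw [exp_DsepT_eq i (r' / 4) δO]
    have : r' / 4 * δO = m / 64 := by rw [hr'def]; field_simp; ring
    rw [this]
  have hEle : E ≤ Real.exp (3 / 128 * m * 3) * Real.exp (-(m / 64 / (2 * ((ℓ : ℝ) + 1)) * ((toKT i).Mh : ℝ))) := by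
    rw [hEdef, ← Real.exp_add, hMhEq]
    refine Real.exp_le_exp.2 ?_
    have hκ : m / 64 / (2 * ((ℓ : ℝ) + 1)) ≤ 3 / 128 * m * (3 / 8) := by
      rw [div_le_iff₀ (by positivity)]
      have h := mul_le_mul_of_nonneg_left hL1 hm.le
      linarith only [h, hm.le]
    have hMh0 : (0 : ℝ) ≤ (i.Mh : ℝ) := by positivity
    linarith only [mul_le_mul_of_nonneg_right hκ hMh0]
  have hd1 : (0 : ℝ) ≤ (d : ℝ) + 1 := by positivity
  have hεE : εT1 * E ≤ εT1 := by simpa using mul_le_mul_of_nonneg_left hE1 hεT1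
  have h1 : εT1 * E * (2 * ((M₂ * ∑ j, ‖b j‖) * BG) + εT1 * E) ≤ εT1 * (2 * ((M₂ * ∑ j, ‖b j‖) * BG) + εT1) * E := by
    calc εT1 * E * (2 * ((M₂ * ∑ j, ‖b j‖) * BG) + εT1 * E) = εT1 * (2 * ((M₂ * ∑ j, ‖b j‖) * BG) + εT1 * E) * E := by ring
      _ ≤ εT1 * (2 * ((M₂ * ∑ j, ‖b j‖) * BG) + εT1) * E := mul_le_mul_of_nonneg_right (mul_le_mul_of_nonneg_left (by linarith only [hεE]) hεT1) hE0
  have h3 : (M₂ * ∑ j, ‖b j‖) * (M₂ * ∑ j, ‖b j‖) * B₁ * (((ℓ : ℝ) + 1) ^ 4) ^ 4 * B6.c1 e11 (1 / 8 * m) (1 / 8) ^ 2 * (((d : ℝ) + 1) * (εT1 * E) * (2 * ((M₂ * ∑ j, ‖b j‖) * BG) + εT1 * E)) ≤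
      (M₂ * ∑ j, ‖b j‖) * (M₂ * ∑ j, ‖b j‖) * B₁ * (((ℓ : ℝ) + 1) ^ 4) ^ 4 * B6.c1 e11 (1 / 8 * m) (1 / 8) ^ 2 * (((d : ℝ) + 1) * (εT1 * (2 * ((M₂ * ∑ j, ‖b j‖) * BG) + εT1) * E)) := by
    refine mul_le_mul_of_nonneg_left ?_ (by positivity)
    calc ((d : ℝ) + 1) * (εT1 * E) * (2 * ((M₂ * ∑ j, ‖b j‖) * BG) + εT1 * E) = ((d : ℝ) + 1) * (εT1 * E * (2 * ((M₂ * ∑ j, ‖b j‖) * BG) + εT1 * E)) := by ring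
      _ ≤ ((d : ℝ) + 1) * (εT1 * (2 * ((M₂ * ∑ j, ‖b j‖) * BG) + εT1) * E) := mul_le_mul_of_nonneg_left h1 hd1
  have h2 : (M₂ * ∑ j, ‖b j‖) * (M₂ * ∑ j, ‖b j‖) * B₁ * (((ℓ : ℝ) + 1) ^ 4) ^ 4 * B6.c1 e11 (1 / 8 * m) (1 / 8) ^ 2 * (((d : ℝ) + 1) * (εT1 * E) * (2 * ((M₂ * ∑ j, ‖b j‖) * BG) + εT1 * E)) + ε31 * E ≤
      ((M₂ * ∑ j, ‖b j‖) * (M₂ * ∑ j, ‖b j‖) * B₁ * (((ℓ : ℝ) + 1) ^ 4) ^ 4 * B6.c1 e11 (1 / 8 * m) (1 / 8) ^ 2 * (((d : ℝ) + 1) * εT1 * (2 * ((M₂ * ∑ j, ‖b j‖) * BG) + εT1)) + ε31) * E := by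
    calc (M₂ * ∑ j, ‖b j‖) * (M₂ * ∑ j, ‖b j‖) * B₁ * (((ℓ : ℝ) + 1) ^ 4) ^ 4 * B6.c1 e11 (1 / 8 * m) (1 / 8) ^ 2 * (((d : ℝ) + 1) * (εT1 * E) * (2 * ((M₂ * ∑ j, ‖b j‖) * BG) + εT1 * E)) + ε31 * E
        ≤ (M₂ * ∑ j, ‖b j‖) * (M₂ * ∑ j, ‖b j‖) * B₁ * (((ℓ : ℝ) + 1) ^ 4) ^ 4 * B6.c1 e11 (1 / 8 * m) (1 / 8) ^ 2 * (((d : ℝ) + 1) * (εT1 * (2 * ((M₂ * ∑ j, ‖b j‖) * BG) + εT1) * E)) + ε31 * E :=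
          add_le_add h3 le_rfl
      _ = ((M₂ * ∑ j, ‖b j‖) * (M₂ * ∑ j, ‖b j‖) * B₁ * (((ℓ : ℝ) + 1) ^ 4) ^ 4 * B6.c1 e11 (1 / 8 * m) (1 / 8) ^ 2 * (((d : ℝ) + 1) * εT1 * (2 * ((M₂ * ∑ j, ‖b j‖) * BG) + εT1)) + ε31) * E := by ring
  rw [hεT_eq, hε₃_eq, hDsep, ← mul_assoc]
  refine le_trans (mul_le_mul_of_nonneg_right (kernel_collect ?_ ?_ ?_ hc22O h2 ?_ hEle) (Real.exp_nonneg _)) (le_of_eq ?_)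
  · positivity
  · positivity
  · positivity
  · positivity
  · rw [hΘ₃def]

end Literature.MathematicalPhysics.QuantumFieldTheory.Balaban1983to89.B9Eq3105FamThreeTAtMember

end
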